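import Literature.NumberTheory.EllipticCurves.AnticyclotomicSignedHeegnerClasses
import Literature.NumberTheory.EllipticCurves.AnticyclotomicSignedTransferInputs
import Literature.NumberTheory.EllipticCurves.BertoliniDarmon2005.AdmissiblePrimes
import Literature.NumberTheory.EllipticCurves.IwasawaAlgebraInvolution
import Literature.NumberTheory.GaloisRepresentations.IntegralGaloisAction
import HarnessLib

/-!
# Castella–Hsu–Kundu–Lee–Liu 2025, §7.2: the signed (`±`) bipartite Euler system of
# Darmon–Iovita / Pollack–Weston (Thm. 7.4) and Howard's rigidity criterion (Thm. 7.5), on the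
# anticyclotomic signed carriers of the tree — the `N⁻m`-ordinary signed Selmer groups
# `Sel±_{N⁻m}(K, T_j)`, the structure of a signed bipartite system, TWO statement-only named facts

Topic `Literature/NumberTheory/EllipticCurves`; namespace
`Literature.NumberTheory.EllipticCurves.CastellaHsuKunduLeeLiu2025` (the paper sub-namespace of the
sibling `HeegnerPointMainConjectureSupersingularBDP.lean`, whose fact `thm71_cor72_…` types Thm. 7.1 /
Cor. 7.2 of the same source in the BDP currency).  HONEST FRAMING: DEFINITIONS with bodies (sets,
additive subgroups, raw families and a raw truncated `ℤ_p⟦T⟧`-action, two structures) + proved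
unfolding lemmas + TWO statement-only NAMED FACTS (`def … : Prop`, D-0014; hypotheses AS PRINTED,
SPECIALISED/RESTRICTED as documented below — each restriction making the typed statement WEAKER than
print or an explicitly flagged READING).  Nothing is asserted, no `_holds`, no instance, no notation,
no module structure is claimed for the new carriers.  Typed ≠ proved ≠ endorsed; the Birch–Swinnerton-
Dyer conjecture is not advanced by this file.

## Why (the consumer, by name)

BSD summit, route `SignedBaseChange`, crux `AnticyclotomicEisensteinDivisibility`
(stmt-BirchSwinnertonDyer-20727), line `admdef` (LEAD memo `Cruxes/…/Lines/admdef-lead-g15.md` §3, §5):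
the registered research stub `stub_chkllPlusRatNS` (Thm. 7.1 / Cor. 7.2 of the source with (i)
`N` square-free NEGATED) is, by the source's own §7, Howard's bipartite-Euler-system criterion [H]
(Thm. 7.5) applied to the Darmon–Iovita/Pollack–Weston `±` system [BES_N] (Thm. 7.4) plus ONE
non-vanishing statement [NV] "`λ±_j(m) ≢ 0 (mod 𝔪)` at one definite vertex" (§7.3–7.4, where
square-freeness and "`E[p]` ramified at `ℓ ∣ N⁺`" enter ONLY through Thm. 7.6 and `t_w(A_g/K)`).  Thms.
7.4 and 7.5 are DISPLAYED under (i) `a_p = 0`, (ii) `p` split, (iii) primes above `p` totally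
ramified in `K_∞/K`, (iv) Condition CR — NO square-free `N`, NO ramification at `ℓ ∣ N⁺`.  With [H] and
[BES_N] typed here as named facts, the research content of the stub narrows to [NV] in the typed
currency (`SignedBipartiteSystem.HasUnitLambda`).

## Sources, VERBATIM (texts read by this seat 2026-08-29; locators = files of the held texts)

* [CastellaEtAl2025] = [CastellaEtAl2023] F. Castella, C.-Y. Hsu, D. Kundu, Y.-S. Lee, Z. Liu, *Derived
  `p`-adic heights and the leading coefficient of the Bertolini–Darmon–Prasanna `p`-adic `L`-function*,
  Trans. Amer. Math. Soc. Ser. B 12 (2025) 748–788 = arXiv:2308.10474v2 (`paper:arxiv-2308.10474`).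
  §7.1 [p0029 L3–L27]: "`E/ℚ` … of conductor `N`, and let `p > 2` be a prime of good supersingular
  reduction for `E`. We assume that (non-ord) `a_p(E) = 0` … Let `K` be an imaginary quadratic field of
  discriminant prime to `N` such that (spl) `p = 𝔭𝔭̄` splits in `K`. … (gen-Heeg) `N⁻` is the
  square-free product of an even number of primes. … Letting `𝒮_±` and `𝒳_±` be the compact Selmer
  groups over `K_∞/K` denoted by `Sel_±(K, T^ac)` and `Sel_±(K, A^ac)^∨` in [CW24, §4.2] … for the
  `Λ`-adic `±`-Heegner class (7.1) `κ^±_∞ ∈ 𝒮_±` constructed in [CW24, §4.1] (where it is denoted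
  `z^±_∞ = cor_{K[1]/K}(z_∞[1]^±)`)."  §7.2 [p0029 L44–L51]: "we say that the pair `(ρ̄, N⁻)` satisfies
  Condition CR if: `ρ̄` is ramified at every prime `ℓ ∣ N⁻` with `ℓ ≡ ±1 (mod p)`, and `ρ̄` is
  surjective."  [p0030 L1–L28]: "We refer the reader to [BD05, p. 18] for the definition of
  `j`-admissible primes (for any `j > 0`) relative to `f`. Denote by `𝓛_j` the set of `j`-admissible
  primes, and by `𝒩_j` the set of square-free products of primes `q ∈ 𝓛_j`. … We decompose
  `𝒩_j = 𝒩_j^ind ⊔ 𝒩_j^def` with `𝒩_j^ind` consisting of the square-free products of an even number of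
  primes `q ∈ 𝓛_j`. Remark 7.3. By definition, admissible primes `q ∈ 𝓛` satisfy in particular
  `q ≢ ±1 (mod p)`. … Let `T = lim←_j E[p^j]` be the `p`-adic Tate module of `E`, and put
  `T_j := lim←_n Ind_{K_n/K}(T/p^jT)`, `A_j := lim→_n Ind_{K_n/K}(E[p^j])`. For every `m ∈ 𝒩_j` the
  "`N⁻m`-ordinary" signed Selmer groups `Sel±_{N⁻m}(K, T_j)`, `Sel±_{N⁻m}(K, A_j)` are defined as in
  [BCK21, p. 1634], with the local conditions at primes `v ∣ p` in loc. cit. replaced by the above local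
  conditions `H¹_±(K_v, T_j)` and `H¹_±(K_v, A_j)` in [CW24, Def. 4.6]. In particular, at the primes
  `q ∤ N⁻mp`, the classes `c ∈ Sel±_{N⁻m}(K, T_j)` are unramified, i.e., `res_q(c) ∈ H¹_unr(K_q, T_j)`,
  while at the primes `q ∣ N⁻m` they are required to land in the "ordinary" submodule `H¹_ord(K_q, T_j)`.
  It is easy to see that for `q ∈ 𝓛`, both `H¹_unr(K_q, T_j)` and `H¹_ord(K_q, T_j)` are free of rank `1`
  over `Λ/p^jΛ` (see e.g. [BCK21, Lem. 2.1])."  **Theorem 7.4 (Darmon–Iovita, Pollack–Weston)**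
  [p0030 L29–L56]: "Suppose that (i) `a_p(E) = 0`. (ii) `p` splits in `K`. (iii) Each prime above `p`
  is totally ramified in `K_∞/K`. (iv) `(ρ̄, N⁻)` satisfies Condition CR. Then for every choice of sign
  `±` and every `j > 0` there is a pair of systems `κ±_j = {κ±_j(m) ∈ Sel±_{N⁻m}(K, T_j) : m ∈ 𝒩_j^ind}`,
  `λ±_j = {λ±_j(m) ∈ Λ/℘^jΛ : m ∈ 𝒩_j^def}`, related by a system of "explicit reciprocity laws": • If
  `mq₁q₂ ∈ 𝒩_j^ind` with `q₁, q₂ ∈ 𝓛_j` distinct primes, then `loc_{q₂}(κ±_j(mq₁q₂)) = λ±_j(mq₁)` under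
  a fixed isomorphism `H¹_ord(K_{q₁}, T_j) ≃ Λ/p^jΛ`. • If `mq ∈ 𝒩_j^def` with `q ∈ 𝓛_j` prime, then
  `loc_q(κ±_j(m)) = λ±_j(mq)` under a fixed isomorphism `H¹_unr(K_q, T_j) ≃ Λ/p^jΛ`. Proof. This is
  shown in [DI08] … under hypotheses (i)–(iii) and an additional hypothesis that `f` is "`p`-isolated"
  … replaced by the weaker hypothesis (iv) above in [PW11] (see [op. cit., §4.3])."  [p0030 L57–L62]:
  "For `m = 1`, the classes `κ±_j := κ±_j(1)` exist for all `j > 0` and are compatible under the natural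
  maps `Sel±_{N⁻}(K, T_{j+1}) → Sel±_{N⁻}(K, T_j)`, thereby defining the class (7.2)
  `lim←_j κ±_j ∈ Sel±_{N⁻}(K, T) := lim←_j Sel±_{N⁻}(K, T_j)`."  [p0031 L1–L12]: "As in [BCK21, Lem. 2.2],
  we have natural isomorphisms `𝒮_± ≃ lim←_j Sel±_{N⁻}(K, T_j)`, `𝒳_± ≃ (lim→_j Sel±_{N⁻}(K, A_j))^∨` …
  Moreover, comparing the construction of the classes `κ±_j(m)` in [DI08, §4] and the construction of
  the classes `z_∞[S]^±` in [CW24, §4.1], we see that (7.2) is the same as the class `κ±_∞` in (7.1).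
  Denote by `𝔪 ⊂ Λ` the maximal ideal."  **Theorem 7.5 (Howard)** [p0031 L13–L30]: "Let the notations
  and hypotheses be as in Theorem 7.4. Then both `𝒮_±` and `𝒳_±` have `Λ`-rank one, and the following
  divisibility holds in `Λ`: `Char_Λ(𝒳^±_tors) ⊃ Char_Λ(𝒮_±/(κ±_∞))²`. Moreover, if for some `j > 0`
  there exists `m ∈ 𝒩_j^def` such that `λ±_j(m)` has non-zero image under the map `Λ/p^jΛ → Λ/𝔪Λ ≃ 𝔽_p`,
  then the above divisibility is an equality. Proof. The element `κ±_∞` is non-torsion by Cornut–Vatsal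
  [CV07] (alternatively, … [CW24, Thm. 6.2] and the non-vanishing of `L^BDP_p`). … by [BCK21, Lem. 3.6]
  it follows that for all `j ≥ j₀` the system `λ±_j` satisfies …: for all height one primes `P ⊂ Λ`, the
  system `λ±_j` contains an element with non-zero image in `Λ/(P, p)`. The result thus follows from
  [How06, Thm. 3.2.3] with `k = k(P) = 1` and the ordinary Selmer condition at the primes above `p`
  replaced by the `±`-condition, noting that the self-duality of the latter is given by [Kim07, Prop.
  4.11], and as shown in [CW24, Lem. 6.5] the analogue of the control theorem of [How06, Prop. 3.3.1]
  follows from [Kim07, Prop. 4.18]."  §7.4 first sentence [p0033 L2–L5], Thm. 7.6 (ii) "`M` is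
  square-free" [p0031 L63], "`t_w(A_g/K) = 0` for all `w ∣ N⁺`" [p0033 L26]: the only places where Thm.
  7.1's hypotheses (i) (square-free) and (ii) (ramification at `ℓ ∣ N⁺`) are used.
* [Howard2006] B. Howard, *Bipartite Euler systems*, J. reine angew. Math. 597 (2006) 1–25, author TeX
  `paper:arxiv-1202.6353`.  §2.2 (p05): "For each `𝔩 ∈ 𝓛` we define the ordinary cohomology
  `H¹_ord(K_𝔩, T)` to be the image of `H¹(K_𝔩, R(1)) → H¹(K_𝔩, T)`.  **Lemma 2.2.1.** For `𝔩 ∈ 𝓛`, the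
  decomposition `T ≅ R ⊕ R(1)` induces a decomposition `H¹(K_𝔩, T) ≅ H¹_unr(K_𝔩, T) ⊕ H¹_ord(K_𝔩, T)` in
  which each summand is free of rank one over `R` … Proof. By [rubin], evaluation of cocycles at
  `Frob_𝔩` induces an isomorphism `H¹_unr(K_𝔩, T) ≅ T/(Frob_𝔩 − 1)T ≅ R` … Since `N(𝔩) ≢ 1 (mod p)`, the
  pro-`p`-completion of `K_𝔩^×` is canonically isomorphic to `ℤ_p`, and so `H¹_ord(K_𝔩, T) ≅
  H¹(K_𝔩, R(1)) ≅ R` by local Kummer theory."  **Def. 2.3.2** (p07; bipartite Euler system of odd type: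
  families `κ_𝔫 ∈ Sel_{𝓕(𝔫)}(K, T)`, `λ_𝔫 ∈ R` with "there exists an isomorphism of `R`-modules
  `R/(λ_𝔫) ≅ H¹_ord(K_𝔩, T)/R·loc_𝔩(κ_{𝔫𝔩})`", resp. `H¹_unr`).  §3.1 (p12): **Def. 3.1.1**
  (`k`-admissible: "`N(𝔩) ≢ 1 (mod p)`, and … `E[p^k] ≅ ℤ/p^kℤ ⊕ μ_{p^k}` of `Gal(K_𝔩^unr/K_𝔩)`-
  modules"); **Lemma 3.1.2** "For any `𝔩 ∈ 𝓛_k` the module `lim←_m H¹_unr(D_{m,𝔩}, E[p^k]) :=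
  lim←_m ⊕_{w ∣ 𝔩} H¹_unr(D_{m,w}, E[p^k])` is free of rank one over `Λ/p^kΛ`, and the same is true with
  unr replaced by ord. Proof. Since `𝔩` splits completely in `D_∞`, Shapiro's lemma gives an isomorphism
  `lim←_m ⊕_{w ∣ 𝔩} H¹(D_{m,w}, E[p^k]) ≅ H¹(K_𝔩, E[p^k] ⊗ Λ) ≅ H¹(K_𝔩, E[p^k]) ⊗ Λ`"; "For any `𝔫 ∈ 𝒩_k`,
  let `𝒮_𝔫(D_∞, E[p^k]) ⊂ lim←_m H¹(D_m, E[p^k])` be the `Λ`-submodule of classes which are ordinary at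
  the primes dividing `𝔫pN⁻`, and unramified at all other primes."  §3.2 (p12–p13): "Suppose that for
  every `k > 0` we are given families (15) `{κ_𝔫 ∈ 𝒮_𝔫(D_∞, E[p^k]) ∣ 𝔫 ∈ 𝒩_k^indefinite}`, `{λ_𝔫 ∈
  Λ/p^kΛ ∣ 𝔫 ∈ 𝒩_k^definite}` which, as `k` varies, are compatible with the inclusion `𝒩_{k+1} ⊂ 𝒩_k`
  and the natural maps `Λ/p^{k+1}Λ → Λ/p^kΛ` and `E[p^{k+1}] →^p E[p^k]`. Assume that these classes
  satisfy the first and second reciprocity laws: • for any `𝔫𝔩 ∈ 𝒩_k^indefinite` there is an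
  isomorphism of `Λ`-modules `lim←_m H¹_ord(D_{m,𝔩}, E[p^k]) ≅ Λ/p^kΛ` taking `loc_𝔩(κ_{𝔫𝔩})` to `λ_𝔫`;
  • for any `𝔫𝔩 ∈ 𝒩_k^definite` there is an isomorphism of `Λ`-modules `lim←_m H¹_unr(D_{m,𝔩}, E[p^k])
  ≅ Λ/p^kΛ` taking `loc_𝔩(κ_𝔫)` to `λ_{𝔫𝔩}`. … we obtain a distinguished element (16) … `κ^∞ ∈ 𝒮`";
  **Thm. 3.2.3** "Assume that the special element (16) is nonzero … (a) `rank_Λ 𝒮 = rank_Λ X = 1` [if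
  `ε(N⁻) = 1`] (b) For any height one prime `𝔭` of `Λ` one has `ord_𝔭(char(X_{Λ-tors})) ≤
  2 · ord_𝔭(char(𝒮/Λκ^∞))` (c) Equality holds in (b) if … there exists a `k₀` such that for all
  `j ≥ k₀` the set `{λ_𝔫 ∈ Λ/p^jΛ ∣ 𝔫 ∈ 𝒩_j^definite}` contains an element with nontrivial image in
  `Λ/(𝔭, p^{k₀})`."
* [BurungaleCastellaKim2021] A. Burungale, F. Castella, C.-H. Kim, Algebra Number Theory 15 (2021)
  1627–1653, author TeX `paper:arxiv-1908.09512` (the journal's §2 = arXiv §7; the source cites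
  "[BCK21, p. 1634 / Lem. 2.1 / Lem. 2.2 / Lem. 3.6]" = arXiv p12 (Selmer groups), the "fixed
  isomorphisms", Lemma 7.1, Prop. 7.4).  arXiv p12: "`Sel^{m-ord}(K_∞, A_f[π^j]) … is the Selmer group of
  [bertolini-darmon-imc-2005], defined by • the ordinary condition `H¹_ord(K_{n,ℓ}, A_f[π^j])` at the
  primes `ℓ ∣ pN⁻m`, • the unramified condition `H¹_unr(K_{n,ℓ}, A_f[π^j])` at all other primes, related
  by a system of (first and second) reciprocity laws … under fixed isomorphisms (see [howard-bipartite])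
  `lim_n H¹_ord(K_{n,q}, A_f[π^j]) ≃ Λ/π^jΛ`, `lim_n H¹_unr(K_{n,q}, A_f[π^j]) ≃ Λ/π^jΛ`"; p13: "For varying
  `j`, the elements `κ_j(m)` and `λ_j(m)` are compatible with the inclusions `𝒩_{j+1} ⊂ 𝒩_j` and the
  natural maps".
* [BertoliniDarmon2005] M. Bertolini, H. Darmon, Ann. of Math. 162 (2005), p. 18 (admissible primes;
  quoted in the tree at `BertoliniDarmon2005.IsAdmissiblePrime`, which is REUSED here, not restated).
* [CastellaWan2023] F. Castella, X. Wan, Math. Ann. 389 (2024): §4.1–4.2 (`z^±_∞`, `Sel_±(K, 𝐓^ac)`,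
  `X_±`), Def. 4.6, Lemma 6.5 — through the sibling carrier files (`AcSigned.*`).

## What is typed here (objects ↦ print)

1. (Part 1) `admissibleProducts / indefProducts / defProducts N K a p j` = `𝒩_j ⊇ 𝒩_j^ind, 𝒩_j^def`:
   square-free products of `j`-admissible primes (`BertoliniDarmon2005.IsAdmissiblePrime N K a p j`,
   with `a ℓ = a_ℓ(f) = W.frobeniusTrace ℓ` in the facts) with an even / odd number of prime factors;
   `1 ∈ 𝒩_j^ind` (`one_mem_indefProducts`).
2. (Part 2) Local conditions away from `p` on the tree's `H¹(H, E[m]) = W.torsionH1Over m H`, at a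
   prime `𝔓` of `K̄` (the tree's `v.primesAbove`, `𝔓.inertia Γ_K`, `𝔓.decompositionSubgroup Γ_K`,
   `IsArithFrobAt`): `unramifiedAt W m H 𝔓 = ker(res : H¹(H, E[m]) → H¹(H ∩ I_𝔓, E[m]))` (the
   UNRAMIFIED classes, print's `H¹_unr`) and `ordinaryAt W m H 𝔓 = ⋂_φ ker(res : H¹(H, E[m]) →
   H¹(⟨φ⟩, E[m]))` over the Frobenius elements `φ ∈ D_𝔓 ∩ H` of `𝔓/K` — READING flag
   `ord-via-Frobenius` below: for `𝔓` over a `j`-admissible `q` and `m = p^j` this IS print's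
   `H¹_ord = im H¹(K_q, Fil⁺)` by the proof of [Howard2006, Lem. 2.2.1].
3. (Part 3) `signedOrdSelmerTorsion W p κ ε m n j ≤ H¹(K_n, E[p^j])` (signed condition
   `AcSigned.condAboveTorsion … (sgn ε)` above `p`; ordinary at every `𝔓` above a prime `ℓ ∣ m`;
   unramified at every other finite `𝔓 ∤ p`) and the compact group **`signedOrdSelmer W p κ γ ε m j =
   Sel^ε_m(K, T_j)`** := `levelAdic … j (signedOrdSelmerTorsion … ε m · j)`, the norm-compatible families
   `(c_n)_n`, `c_n ∈ Sel^ε_{m}(K_n, E[p^j])` — VERBATIM Howard's model "`𝒮_𝔫(D_∞, E[p^k]) ⊂ lim←_m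
   H¹(D_m, E[p^k])` … ordinary at the primes dividing `𝔫pN⁻`, unramified at all other primes" with the
   condition above `p` replaced by the signed one (the source's sentence) and `N⁻ = 1` (restriction
   (R2)); = the source's `Sel±_{N⁻m}(K, T_j)` under Shapiro's lemma `H¹(K, T_j) = lim←_n H¹(K_n, E[p^j])`
   (the identification the tree already uses for `AcSigned.lambdaAdic` / `LambdaAdicSelmerData`).
4. (Part 4) The local `Λ`-adic targets at a prime `𝔮 = q𝓞_K` that SPLITS COMPLETELY in `K_∞` (every
   admissible `q`: inert in `K`, hence totally split in the anticyclotomic tower — tree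
   `AnticyclotomicInertPrimeTotallySplitProofs`): trace-compatible ("coinduced") families
   `u = (u_n : ℤ/p^n → U)_n` (`IsCoinducedIn B u`, values in a subgroup `B ≤ U`), the raw truncated
   `Λ = ℤ_p⟦T⟧`-action `coTsmul p j f u` (`T ↦ shift − 1`, the tree's `IwasawaDual.evalT` truncated at
   `T^{j pⁿ}`, `p^j`; the SAME formula as the tree's `AcSigned.tsmul`), and the raw localisation families
   of a global family `x = (x_n)`: `unrLoc … hφ x` (`a ↦ res_{⟨φ⟩}(conj_{γ^a}⁻¹ x_n)`, values in
   `U = H¹(⟨φ⟩, E[p^j])`, `φ` a Frobenius of `𝔓` in `Gal(K̄/K_∞)`) and `ordLoc … 𝔓 x` (`a ↦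
   res_{I_𝔓 ∩ Gal(K̄/K_∞)}(conj_{γ^a}⁻¹ x_n)`, values in `U = H¹(I_𝔓 ∩ Gal(K̄/K_∞), E[p^j])`, in which the
   ordinary line is `ordLine … 𝔓 = res(H¹(D_𝔓 ∩ Gal(K̄/K_∞), E[p^j]))`).  This is [Howard2006, Lem. 3.1.2]'s
   "`lim←_m ⊕_{w∣𝔩} H¹_?(D_{m,w}, E[p^k]) ≅ H¹_?(K_𝔩, E[p^k]) ⊗ Λ`" (places of `K_n` above `𝔮` ↔
   `Γ/Γ^{pⁿ}` ↔ `ℤ/p^n` via `γ^a`), composed with the injections `H¹_unr(K_𝔮, E[p^j]) ↪ H¹(⟨φ⟩, E[p^j])`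
   (evaluation at Frobenius, Lem. 2.2.1) and `H¹_ord(K_𝔮, E[p^j]) ↪ H¹(I_𝔮, E[p^j])` (restriction to
   inertia kills exactly `H¹_unr`).  A reciprocity law "there is an isomorphism of `Λ`-modules
   `M ≅ Λ/p^jΛ` taking `x` to `λ`" for `M` free of rank one over the LOCAL ring `Λ/p^jΛ` is EQUIVALENT to
   `Λ·x = λ·M` (both say `x = uλe` for a generator `e` and a unit `u`); the latter is typed raw as
   `SpanEqSmul p j λ x M := (∃ y ∈ M, x = λ·y) ∧ (∀ y ∈ M, ∃ f, λ·y = f·x)` (flag `law-as-lines`).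
5. (Part 5) `structure SignedBipartiteSystem` (raw data `kappa j m ∈ ∏_n H¹(K_n, E[p^j])`,
   `lam j m ∈ Λ` = a LIFT of `λ_j(m) ∈ Λ/p^jΛ`) and the `Prop`-structure
   **`IsSignedBipartiteSystem W K p κ γ N ε B`**: `kappa j m ∈ Sel^ε_m(K, T_j)` for `m ∈ 𝒩_j^ind`;
   compatibility in `j` (`p_* κ_{j+1}(m) = κ_j(m)`, `λ_{j+1}(m) ≡ λ_j(m) mod p^j`); the first law (for
   `mq ∈ 𝒩_j^ind`, `q ∈ 𝓛_j`, `q ∤ m`: `Λ·ordLoc_𝔓(κ_j(mq)) = λ_j(m)·(coinduced families in the ordinary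
   line)` at every `𝔓` over `q`) and the second law (for `mq ∈ 𝒩_j^def`: `Λ·unrLoc_φ(κ_j(m)) =
   λ_j(mq)·(all coinduced families in H¹(⟨φ⟩, E[p^j]))` for every Frobenius `φ` of every `𝔓` over
   `q`); `B.IsLimitBaseClass z` ("`z_{n,j} = κ_j(1)_n`": (7.2)) and `B.HasUnitLambda …` ("for some
   `j > 0` there exists `m ∈ 𝒩_j^def` such that `λ±_j(m)` has non-zero image under `Λ/p^jΛ → Λ/𝔪Λ ≃
   𝔽_p`": the constant coefficient of the lift is a unit of `ℤ_p`).
6. (Part 6) TWO NAMED FACTS: `thm74_exists_signedBipartiteSystem` (Thm. 7.4 with (7.2) and the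
   identification [p0031 L10–L12] of `lim_j κ±_j(1)` with the class of [CW24, §4.1], in the tree's
   pinning `AcSigned.IsSignedHeegnerClass`) and `thm75_howard_rank_one_sq_le_and_le_of_hasUnitLambda`
   (Thm. 7.5 = [Howard2006, Thm. 3.2.3] in the `±` setting, for EVERY signed bipartite system whose base
   class `lim_j κ_j(1) ∈ 𝒮_ε` is not `Λ`-torsion).
7. (Part 7, PROVED bookkeeping) `AcSigned.TransferInputs.isNonTorsionClass` (a class admitted by the
   sibling `TransferInputs … ε z L` is not `Λ`-torsion, from the tree's `TransferInputs.smul_eq_zero_imp`)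
   and `thm75_of_transferInputs` (Thm. 7.5's conclusions for such a `z` that is the limit base class of a
   signed bipartite system; equality under `HasUnitLambda`).

## RESTRICTIONS of the transcription (each makes the typed statements WEAKER than print) and READINGS

(R1) `5 ≤ p` (display: `p > 2`).  At `p = 3` there are no admissible primes
(`Literature.Barriers.BirchSwinnertonDyer.NoAdmissiblePrimesAtThree`, `BertoliniDarmon2005.not_isAdmissiblePrime_three`)
and [Howard2006] stands at `p ∤ 6N`; the source's §7 must be read `p ≥ 5` (barrier entry, `blocks:`).
-- TODO(general form): `p = 3`, `a_3 = 0` (the displayed hypothesis).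
(R2) `N⁻ = 1`: EVERY prime `ℓ ∣ N` splits in `K` (`SatisfiesHeegnerHypothesis N K`), so (gen-Heeg)
holds with `N⁻ = 1`, the first bullet of CR is vacuous and `Sel±_{N⁻m} = Sel±_m`; "discriminant prime
to `N`" kept verbatim (`IsCoprime (N : ℤ) (discr K)`).  -- TODO(general form): `N⁻ ≠ 1`.
(R3) `AcSigned.Setting W K p κ 𝔭 𝔭'` (sibling files): `E` elliptic on a global minimal model `W` (to read
`a_ℓ = W.frobeniusTrace ℓ`), `p` odd of good supersingular reduction with `a_p = 0` ((i)), `K`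
imaginary quadratic, `p = 𝔭𝔭'` SPLIT ((ii)), `κ` THE anticyclotomic `ℤ_p`-extension, and `p ∤ h_K` — the
printed SUFFICIENT condition for (iii) (flag `tot-ram-via-h_K` of the sibling files; WEAKER).
(R4) CR's second bullet "`ρ̄` surjective" = `Rank1Residual.Surj W p`.
(R5) Thm. 7.5's input "`κ±_∞` is non-torsion" (Cornut–Vatsal / [CW24, Thm. 6.2] in the printed proof)
is an explicit HYPOTHESIS of `thm75_…` (`AcSigned.IsNonTorsionClass`), and the fact is stated for EVERY
signed bipartite system through such a class — literally [Howard2006, Thm. 3.2.3] ("Assume that the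
special element (16) is nonzero"; `𝒮` is torsion-free, Lemma 3.2.2) with the `±` modifications the
source lists; the source's Thm. 7.5 is this theorem applied to the system of Thm. 7.4.
(R6) The conclusions of Thm. 7.5 are typed on the tree's carriers `𝒮_ε = AcSigned.selmerLambdaAdic …
(sgn ε)` and `𝒳_ε = AcSigned.X … ∅ (sgn ε)` (flags `CW24-local-condition`, `away-p`, `HLV-vs-Kob-layers`
of the sibling files; the source's "`𝒮_± ≃ lim_j Sel±_{N⁻}(K, T_j)`" [p0031 L1] is the bridge) through
`selmerLambdaAdic.HasRank … 1`, `X.HasRank … 1`, and INEQUALITIES OF IDEALS in the orientation of the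
sibling transfer theorem `AcSigned.TransferInputs.mem_XAc_charIdeal_map_of_howard` (hypothesis
`hHoward`): `(signedHeegnerCharIdeal hγ ε z).map ι ^ 2 ≤ X.torsionCharIdeal …` for "`Char_Λ(𝒳_tors) ⊃
Char_Λ(𝒮/(κ_∞))²`", `ι = IwasawaAlgebra.invol` — flag `dual-convention` of
`AnticyclotomicSignedTransferInputs.lean` (the tree's `X` carries the PRECOMPOSITION `Λ`-action, under
which the Howard-side statement reads with `ι`; for these `(ε, ε)` objects the `ι`-free form — the form
of the sibling `castellaWan2024_thmA5_signedSelmer_rank_one_dvd_sq` — is equivalent by the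
complex-conjugation symmetry `Char = Char^ι` of these modules, [BCK21, Thm. 3.1 (iii)] / Howard 2004
Thm. B, printed, not in the tree).
READINGS (informational; where the transcription is a reading, not a printed sentence):
* `Shapiro` / `coinduced`: `H¹(K, T_j) = lim←_n H¹(K_n, E[p^j])` (norm-compatible families: [Howard2006]
  §3.1's own model), and at a prime `𝔮` split completely in `K_∞`, `H¹_?(K_𝔮, T_j) = lim_n ⊕_{w∣𝔮}
  H¹_?(K_{n,w}, E[p^j]) = H¹_?(K_𝔮, E[p^j]) ⊗ Λ/p^j` ([Howard2006, Lem. 3.1.2], proof), the places of `K_n`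
  above `𝔮` being the `Γ/Γ^{pⁿ}`-translates of the place under a fixed `𝔓` (so `D_𝔓 ⊆ Gal(K̄/K_∞)`):
  the coordinate families `unrLoc`, `ordLoc` index them by `a ∈ ℤ/p^n ↦ γ^a`.
* `ord-via-Frobenius`: for `𝔓` over a `j`-admissible `q` (so `E[p^j]` is unramified at `q` and
  `E[p^j] ≅ ℤ/p^j ⊕ μ_{p^j}` under `D_𝔓/I_𝔓`, `Frob_𝔮` acting by `1` and `q² ≢ 1 (mod p)`), print's
  `H¹_ord(K_𝔮, E[p^j]) = im H¹(K_𝔮, μ_{p^j})` is EXACTLY the kernel of restriction to the procyclic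
  group `⟨φ⟩` of a Frobenius `φ`: `H¹(⟨φ⟩, E[p^j]) = E[p^j]/(φ − 1) = ℤ/p^j ⊕ μ_{p^j}/(q² − 1) = ℤ/p^j`
  receives `H¹_unr = H¹(D/I, E[p^j]) ≅ E[p^j]/(φ − 1)` isomorphically ("evaluation of cocycles at
  `Frob_𝔩`", [Howard2006, Lem. 2.2.1, proof]) and kills `im H¹(K_𝔮, μ_{p^j})` (its classes restrict into
  `H¹(⟨φ⟩, μ_{p^j}) = 0`); dually restriction to `I_𝔓` kills exactly `H¹_unr` and embeds `H¹_ord`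
  (`H¹_unr(K_𝔮, μ_{p^j}) = μ_{p^j}/(q² − 1) = 0`), whence `ordLine`.  Independent of the Frobenius lift
  (two lifts differ by `i ∈ I_𝔓`, acting trivially on `E[p^j]`, and `y(i) ∈ μ`-line `⊆ (φ − 1)E[p^j]`).
* `law-as-lines`: see item 4; the "fixed isomorphisms" of the source / "there is an isomorphism" of
  [Howard2006] (15) leave `λ` determined up to `(Λ/p^j)^×`, which changes nothing below; a different
  choice of `𝔓` above `q` or of `φ` transports/shifts the coordinate family (`γ^b`-shift = multiplication
  by the unit `(1+T)^b`), so the laws are stated "for every `𝔓`, every `φ`".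
* `index-convention`: the family is indexed by `a ↦ conj_{γ^a}⁻¹`; the opposite convention replaces
  every `λ` by `ι(λ)` simultaneously — immaterial for existence (Thm. 7.4), for the `λ`-free conclusions
  and for `HasUnitLambda` (`ι` preserves `𝔪`).
* `lambda-lift`: `λ_j(m) ∈ Λ/p^jΛ = Λ/℘^jΛ` (`𝒪 = ℤ_p`, `℘ = p` for `f = f_E`) is carried by a lift in
  `Λ`; the laws (targets killed by `p^j`), the compatibility (`mod p^j`) and `HasUnitLambda` (`p^jΛ ⊆ 𝔪`)
  are invariant under changing the lift.
* `law-typo`: the source's first law names "`H¹_ord(K_{q₁}, T_j)`" for the target of `loc_{q₂}`; read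
  `K_{q₂}`, as in [Howard2006] (15) and [BCK21] (1st): `loc_q(κ(nq)) ↔ λ(n)` in `H¹_ord(K_q, T_j)`,
  `nq ∈ 𝒩^ind` — the form typed (`first_law`, with `n = mq₁`, `q = q₂`).
* `compat-all-m`: compatibility in `j` is displayed by the source for `m = 1` only [p0030 L57]; it is
  part of the DEFINITION of the `Λ`-adic system that Thm. 7.5's proof feeds to [Howard2006, Thm. 3.2.3]
  ((15): "which, as `k` varies, are compatible …") and is printed for the Bertolini–Darmon system in
  [BCK21, arXiv p13]; it is a field of `IsSignedBipartiteSystem` for all `m`.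
* `away-p-unr`: at primes `ℓ ∣ N (= N⁺)` the condition is UNRAMIFIED, as printed ([BCK21] "unramified
  condition at all other primes", [Howard2006] §3.1), not the classical Kummer condition of the tree's
  `AcSigned.selmerTorsion`; no condition at the (complex) archimedean places ([Howard2006, Rem. 2.1.2]).
  The clause "`z ∈ AcSigned.selmerLambdaAdic … (sgn ε)`" of the facts is the source's bridge
  `𝒮_± ≃ lim_j Sel±_{N⁻}(K, T_j)` [p0031 L1–L8, after BCK21 Lem. 2.2].
* `CHKLL-inputs` (as for the sibling Thm. 7.1 fact): Thm. 7.4's proof is "[DI08] + [PW11, §4.3]", sources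
  standing in the definite setting at square-free level; the source asserts the indefinite-setting,
  arbitrary-`N⁺` statement (the port is implicit in print).  Refereed (Trans. AMS Ser. B, 2025).
* `heegner-family` (sibling `coherent-family`, `CW24-sign`, `delta-zero`): "(7.2) is the same as the
  class `κ±_∞` … constructed in [CW24, §4.1]" is typed, as in the sibling facts, for EVERY trace-coherent
  `HeegnerFamily` `F` of level `N` with a system DEPENDING on `F` (`∀ F, ∃ B`): the Darmon–Iovita
  construction runs for any modular parametrisation, and a rescaled family `c·F` carries the rescaled
  system `(c·κ, c·λ)`, which satisfies the same memberships and laws.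

## NOT typed here (and why)

* (T5 of the request) "[NV′] ⟹ [NV]": §7.4's "by the construction of `λ±_j`" + (7.4) `L±_p(g/K) =
  Θ±_∞(g/K)²` needs definite theta elements of level-raised forms ([CH18b], [BBL24 Thm. 3.5]) — the tree
  has Brandt-module files but no theta elements; left to a later row.  Thm. 7.6, Remark 7.7, §7.4's
  proof (Thm. 7.1 itself is the sibling fact).
* NO `Λ`-module structure on the new carriers is constructed or asserted (the raw actions `coTsmul`, and
  the tree's `AcSigned.tsmul` on global families, are what the laws use); freeness of rank one of the
  local targets ([BCK21, Lem. 2.1] / [Howard2006, Lem. 3.1.2]), the identifications of the READINGS, the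
  existence of Frobenius elements (the tree's fact `exists_isArithFrobAt_of_mem_primesAbove`) and the
  complete splitting of admissible primes in `K_∞` are documented, not proved, and NOT hypotheses of the
  facts (they hold; the typed local conditions are print's conditions under them).
* The (7.2)-clause is NOT stated against the binder `AcSigned.TransferInputs … ε z L` of the sibling
  fact `castellaWan2024_proofThm68_transferInputs` ("`∃ u ∈ Λˣ, lim_j κ_j(1) = u • z` for every
  admissible `(z, L)`"): that form is print PLUS [CW24, §6] for the class `z^±_∞` PLUS a class/frame
  rigidity across frames, a chain this seat cannot certify from print; the tree's direct pinning of
  "the class constructed in [CW24, §4.1]" is `AcSigned.IsSignedHeegnerClass`, used here.  A consumer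
  holding an admissible non-torsion `z` (tree: `TransferInputs.smul_eq_zero_imp`) applies `thm75_…` to
  any signed bipartite system `B` with `B.IsLimitBaseClass z.1`.
* No new named fact besides the two theorems of the source; no conjecture ([CW24, Conj. 4.8] is the
  conclusion shape, never asserted).
-/

noncomputable section

open scoped Classical

open NumberField IsDedekindDomain Field
open Literature.NumberTheory.EllipticCurves Literature.NumberTheory.GaloisRepresentations
open Literature.NumberTheory.EllipticCurves.AcSigned Literature.NumberTheory.EllipticCurves.IwasawaDual
open Literature.NumberTheory.EllipticCurves.BertoliniDarmon2005
open WeierstrassCurve (geomTorsion)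

universe u

namespace Literature.NumberTheory.EllipticCurves.CastellaHsuKunduLeeLiu2025

/-! ## Part 1. Square-free products of `j`-admissible primes: `𝒩_j = 𝒩_j^ind ⊔ 𝒩_j^def` -/

section Products

variable (N : ℕ) (K : Type u) [Field K] (a : ℕ → ℤ) (p j : ℕ)

/-- **`𝒩_j`**: the set of square-free products `m` of `j`-admissible primes relative to the level `N`,
the field `K`, the Hecke eigenvalues `a` and the prime `p` (the tree's
`BertoliniDarmon2005.IsAdmissiblePrime N K a p j`, [BD05, p. 18], REUSED).  Printed: "Denote by `𝓛_j`
the set of `j`-admissible primes, and by `𝒩_j` the set of square-free products of primes `q ∈ 𝓛_j`"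
(the empty product `1` included). [cite: CastellaEtAl2025, §7.2 (arXiv:2308.10474v2 p0030 L1–L6)]
[cite: BertoliniDarmon2005, p. 18 (Admissible primes)] -/
def admissibleProducts : Set ℕ :=
  {m | Squarefree m ∧ ∀ q : ℕ, q.Prime → q ∣ m → IsAdmissiblePrime N K a p j q}

/-- **`𝒩_j^ind`**: the square-free products of an EVEN number of `j`-admissible primes ("indefinite"
vertices; with `N⁻ = 1` these index the classes `κ_j(m)`).  Printed: "`𝒩_j = 𝒩_j^ind ⊔ 𝒩_j^def` with
`𝒩_j^ind` consisting of the square-free products of an even number of primes `q ∈ 𝓛_j`."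
[cite: CastellaEtAl2025, §7.2 (arXiv:2308.10474v2 p0030 L4–L6)] [cite: Howard2006, Def. 3.2.1] -/
def indefProducts : Set ℕ :=
  {m | m ∈ admissibleProducts N K a p j ∧ Even m.primeFactors.card}

/-- **`𝒩_j^def`**: the square-free products of an ODD number of `j`-admissible primes ("definite"
vertices, indexing the elements `λ_j(m)`). [cite: CastellaEtAl2025, §7.2 (arXiv:2308.10474v2 p0030 L4–L6)]
[cite: Howard2006, Def. 3.2.1] -/
def defProducts : Set ℕ :=
  {m | m ∈ admissibleProducts N K a p j ∧ Odd m.primeFactors.card}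

variable {N K a p j}

/-- Unfolding `admissibleProducts`. [cite: CastellaEtAl2025, §7.2 (arXiv:2308.10474v2 p0030 L1–L6)] -/
theorem mem_admissibleProducts_iff {m : ℕ} : m ∈ admissibleProducts N K a p j ↔
    Squarefree m ∧ ∀ q : ℕ, q.Prime → q ∣ m → IsAdmissiblePrime N K a p j q :=
  Iff.rfl

/-- Unfolding `indefProducts`. [cite: CastellaEtAl2025, §7.2 (arXiv:2308.10474v2 p0030 L4–L6)] -/
theorem mem_indefProducts_iff {m : ℕ} : m ∈ indefProducts N K a p j ↔
    m ∈ admissibleProducts N K a p j ∧ Even m.primeFactors.card :=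
  Iff.rfl

/-- Unfolding `defProducts`. [cite: CastellaEtAl2025, §7.2 (arXiv:2308.10474v2 p0030 L4–L6)] -/
theorem mem_defProducts_iff {m : ℕ} : m ∈ defProducts N K a p j ↔
    m ∈ admissibleProducts N K a p j ∧ Odd m.primeFactors.card :=
  Iff.rfl

variable (N K a p j) in
/-- The empty product `1` lies in `𝒩_j` ("When `j = 1`, we suppress it from the notations"; the vertex
`m = 1` carries `κ_j(1)`). [cite: CastellaEtAl2025, §7.2 and (7.2) (arXiv:2308.10474v2 p0030)] -/
theorem one_mem_admissibleProducts : 1 ∈ admissibleProducts N K a p j :=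
  ⟨squarefree_one, fun _ hq hq1 ↦ absurd (Nat.eq_one_of_dvd_one hq1 ▸ hq) Nat.not_prime_one⟩

variable (N K a p j) in
/-- The empty product `1` is an indefinite vertex (`0` prime factors): `1 ∈ 𝒩_j^ind`, the index of the
base classes `κ_j(1)` of (7.2). [cite: CastellaEtAl2025, §7.2 and (7.2) (arXiv:2308.10474v2 p0030 L57–L62)] -/
theorem one_mem_indefProducts : 1 ∈ indefProducts N K a p j :=
  ⟨one_mem_admissibleProducts N K a p j, by simp⟩

/-- `1 ∉ 𝒩_j^def` (it has no prime factor): definite vertices are products of at least one admissible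
prime. [cite: CastellaEtAl2025, §7.2 (arXiv:2308.10474v2 p0030 L4–L6)] -/
theorem one_not_mem_defProducts : 1 ∉ defProducts N K a p j := by
  simp [defProducts]

/-- `𝒩_{j'} ⊆ 𝒩_j` for `j ≤ j'` (a `j'`-admissible prime is `j`-admissible,
`IsAdmissiblePrime.of_le`) — the inclusions "`𝒩_{k+1} ⊂ 𝒩_k`" along which the systems are compatible.
[cite: Howard2006, §3.2 (15)] [cite: BertoliniDarmon2005, p. 18 (Admissible primes)] -/
theorem admissibleProducts_anti {j j' : ℕ} (h : j ≤ j') :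
    admissibleProducts N K a p j' ⊆ admissibleProducts N K a p j :=
  fun _ hm ↦ ⟨hm.1, fun q hq hqm ↦ (hm.2 q hq hqm).of_le h⟩

end Products

/-! ## Part 2. Local conditions away from `p`: unramified classes, and ordinary classes at a prime
over an admissible `q` -/

section LocalConditions

variable {K : Type u} [Field K] (W : WeierstrassCurve K) (m : ℤ)
  (H : Subgroup (absoluteGaloisGroup K)) (𝔓 : Ideal (absIntegers (𝓞 K) K))

/-- **Unramified classes at the prime `𝔓` of `K̄`**: the classes of `H¹(H, E[m])` (`H = Gal(K̄/L)`)
whose restriction to the inertia group `I_𝔓 ∩ H` of `𝔓` in `Gal(K̄/L)` vanishes — `H¹_unr(L_w, E[m]) =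
ker(H¹(L_w, E[m]) → H¹(I_w, E[m]))` at the place `w` of `L` under `𝔓`, pulled back to `H¹(L, E[m])`
(restriction to the decomposition group followed by restriction to inertia is restriction to inertia).
The condition "at the primes `q ∤ N⁻mp`, the classes … are unramified, i.e., `res_q(c) ∈
H¹_unr(K_q, T_j)`" of the source, levelwise. [cite: CastellaEtAl2025, §7.2 (arXiv:2308.10474v2 p0030 L20–L24)]
[cite: Howard2006, Def. 2.1.1 and §3.1] -/
def unramifiedAt : AddSubgroup (W.torsionH1Over m H) :=
  (resOfLe (geomTorsion W m) (inf_le_left : H ⊓ 𝔓.inertia (absoluteGaloisGroup K) ≤ H)).ker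

/-- **Ordinary classes at the prime `𝔓` of `K̄` (for `𝔓` over a `j`-admissible prime, `m = p^j`)**: the
classes of `H¹(H, E[m])` whose restriction to the procyclic group `⟨φ⟩` vanishes for every Frobenius
element `φ ∈ D_𝔓 ∩ H` of `𝔓` over `K` (`IsArithFrobAt (𝓞 K) φ 𝔓`; for `𝔮 = q𝓞_K` split completely in
`L = K̄^H` these are the Frobenius elements of the place of `L` under `𝔓`).  Printed: "at the primes
`q ∣ N⁻m` they are required to land in the "ordinary" submodule `H¹_ord(K_q, T_j)`", `H¹_ord = im
H¹(K_𝔮, μ_{p^j}) = im H¹(K_𝔮, R(1))` ([Howard2006] §2.2).  READING `ord-via-Frobenius` (module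
docstring): for a `j`-admissible `q` — `E[p^j]` unramified at `q`, `E[p^j] ≅ ℤ/p^j ⊕ μ_{p^j}` under
`Frob_𝔮`, `q² ≢ 1 (mod p)` — restriction to `⟨Frob_𝔮⟩` is "evaluation of cocycles at `Frob_𝔩`", an
isomorphism `H¹_unr ≅ E[p^j]/(Frob_𝔮 − 1)` ([Howard2006, Lem. 2.2.1, proof]) killing exactly `H¹_ord`,
so this IS print's ordinary submodule. [cite: CastellaEtAl2025, §7.2 (arXiv:2308.10474v2 p0030 L22–L27)]
[cite: Howard2006, §2.2 (ordinary cohomology) and Lem. 2.2.1] -/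
def ordinaryAt : AddSubgroup (W.torsionH1Over m H) :=
  ⨅ (φ : absoluteGaloisGroup K) (hφ : φ ∈ H)
    (_ : φ ∈ 𝔓.decompositionSubgroup (absoluteGaloisGroup K)) (_ : IsArithFrobAt (𝓞 K) φ 𝔓),
    (resOfLe (geomTorsion W m) (Subgroup.zpowers_le.mpr hφ)).ker

variable {W m H 𝔓}

/-- Membership in `unramifiedAt`: the restriction to `H ∩ I_𝔓` vanishes.
[cite: Howard2006, Def. 2.1.1 (the unramified condition)] -/
theorem mem_unramifiedAt_iff (c : W.torsionH1Over m H) : c ∈ unramifiedAt W m H 𝔓 ↔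
    resOfLe (geomTorsion W m) (inf_le_left : H ⊓ 𝔓.inertia (absoluteGaloisGroup K) ≤ H) c = 0 :=
  Iff.rfl

/-- Membership in `ordinaryAt`: the restriction to `⟨φ⟩` vanishes for every Frobenius `φ ∈ D_𝔓 ∩ H`.
[cite: Howard2006, §2.2 and Lem. 2.2.1] -/
theorem mem_ordinaryAt_iff (c : W.torsionH1Over m H) : c ∈ ordinaryAt W m H 𝔓 ↔
    ∀ (φ : absoluteGaloisGroup K) (hφ : φ ∈ H), φ ∈ 𝔓.decompositionSubgroup (absoluteGaloisGroup K) →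
      IsArithFrobAt (𝓞 K) φ 𝔓 → resOfLe (geomTorsion W m) (Subgroup.zpowers_le.mpr hφ) c = 0 := by
  simp only [ordinaryAt, AddSubgroup.mem_iInf, AddMonoidHom.mem_ker]

end LocalConditions

/-! ## Part 3. The `m`-ordinary signed Selmer groups `Sel^ε_m(K_n, E[p^j])` and
`Sel^ε_m(K, T_j) = lim←_n` (norm-compatible families; `N⁻ = 1`) -/

section LevelAdic

variable {K : Type u} [Field K] (W : WeierstrassCurve K) (p : ℕ) [Fact p.Prime]
  (κ : ZpExtension K p) (γ : absoluteGaloisGroup K)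

/-- **`H¹_C(K, T_j) := lim←_n H¹_{C_n}(K_n, E[p^j])`** for a family of level conditions
`C n ≤ H¹(K_n, E[p^j])` at a FIXED torsion level `p^j`: the additive subgroup of
`∏_n H¹(K_n, E[p^j])` of the families `x = (x_n)` with `x_n ∈ C n` and the norm compatibility
`res_{K_n → K_{n+1}} x_n = Σ_{i<p} conj_{γ^{pⁿ i}} x_{n+1}` (`res ∘ cor = N_{K_{n+1}/K_n}`, the convention of
the tree's `WeierstrassCurve.LambdaAdicSelmerData.proj_norm` and `AcSigned.lambdaAdic`, which is the
two-index (`n`, `m`) version of this object).  This is the model of `H¹(K, T_j)`, `T_j = lim←_n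
Ind_{K_n/K}(T/p^jT)` (the source), `= lim←_m H¹(D_m, E[p^k])` ([Howard2006] §3.1), under Shapiro's lemma
(flag `Shapiro`). [cite: CastellaEtAl2025, §7.2 (arXiv:2308.10474v2 p0030 L14–L16)] [cite: Howard2006, §3.1] -/
def levelAdic (j : ℕ) (C : ∀ n : ℕ, AddSubgroup (W.torsionH1Over ((p : ℤ) ^ j) (κ.layerSubgroup n))) :
    AddSubgroup (Π n : ℕ, W.torsionH1Over ((p : ℤ) ^ j) (κ.layerSubgroup n)) where
  carrier := {x | (∀ n, x n ∈ C n) ∧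
    ∀ n, resOfLe (geomTorsion W ((p : ℤ) ^ j)) (κ.layerSubgroup_antitone (Nat.le_succ n)) (x n) =
      ∑ i ∈ Finset.range p,
        conjH1 (κ.layerSubgroup (n + 1)) (geomTorsion W ((p : ℤ) ^ j)) (γ ^ (p ^ n * i)) (x (n + 1))}
  zero_mem' := ⟨fun n ↦ zero_mem _, fun n ↦ by simp⟩
  add_mem' := fun {x y} hx hy ↦ ⟨fun n ↦ add_mem (hx.1 n) (hy.1 n), fun n ↦ by
    rw [Pi.add_apply, Pi.add_apply, map_add, hx.2 n, hy.2 n, ← Finset.sum_add_distrib]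
    exact Finset.sum_congr rfl fun i _ ↦ (map_add _ _ _).symm⟩
  neg_mem' := fun {x} hx ↦ ⟨fun n ↦ neg_mem (hx.1 n), fun n ↦ by
    rw [Pi.neg_apply, Pi.neg_apply, map_neg, hx.2 n, ← Finset.sum_neg_distrib]
    exact Finset.sum_congr rfl fun i _ ↦ (map_neg _ _).symm⟩

variable {W p κ γ} in
/-- Membership in `levelAdic j C` (unfolding). [cite: Howard2006, §3.1] -/
theorem mem_levelAdic_iff {j : ℕ}
    {C : ∀ n : ℕ, AddSubgroup (W.torsionH1Over ((p : ℤ) ^ j) (κ.layerSubgroup n))}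
    (x : Π n : ℕ, W.torsionH1Over ((p : ℤ) ^ j) (κ.layerSubgroup n)) :
    x ∈ levelAdic W p κ γ j C ↔ (∀ n, x n ∈ C n) ∧
      ∀ n, resOfLe (geomTorsion W ((p : ℤ) ^ j)) (κ.layerSubgroup_antitone (Nat.le_succ n)) (x n) =
        ∑ i ∈ Finset.range p,
          conjH1 (κ.layerSubgroup (n + 1)) (geomTorsion W ((p : ℤ) ^ j)) (γ ^ (p ^ n * i)) (x (n + 1)) :=
  Iff.rfl

variable {W p κ γ} in
/-- `levelAdic` is monotone in the level conditions (relaxing local conditions enlarges the Selmer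
module — the inclusions `𝒮_{𝔫,𝔩} ⊆ 𝒮_𝔫 ⊆ 𝒮^𝔩_𝔫` of [Howard2006] Prop. 2.2.9). [cite: Howard2006, Prop. 2.2.9 and §3.1] -/
theorem levelAdic_mono {j : ℕ}
    {C C' : ∀ n : ℕ, AddSubgroup (W.torsionH1Over ((p : ℤ) ^ j) (κ.layerSubgroup n))}
    (h : ∀ n, C n ≤ C' n) : levelAdic W p κ γ j C ≤ levelAdic W p κ γ j C' :=
  fun _ hx ↦ ⟨fun n ↦ h n (hx.1 n), hx.2⟩

end LevelAdic

section Selmer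

variable {K : Type u} [Field K] [NumberField K] (W : WeierstrassCurve K) (p : ℕ) [Fact p.Prime]
  (κ : ZpExtension K p) (γ : absoluteGaloisGroup K)

/-- **`Sel^ε_m(K_n, E[p^j]) ⊆ H¹(K_n, E[p^j])`**, the level-`n` term of the `N⁻m`-ordinary signed
Selmer group for `N⁻ = 1`: the signed condition `ℋ^ε` (the tree's `AcSigned.condAboveTorsion … (sgn ε)`,
Castella–Wan Def. 4.6 as read by the sibling files) at every `v ∣ p`; ORDINARY (`ordinaryAt`) at every
prime `𝔓` of `K̄` above a finite `v ∤ p` lying over a rational prime `ℓ ∣ m`; UNRAMIFIED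
(`unramifiedAt`) at every prime `𝔓` above every other finite `v ∤ p` (including `v ∣ N`; flag
`away-p-unr`); no condition at the archimedean places (complex).  Printed: "`Sel±_{N⁻m}(K, T_j)` …
defined as in [BCK21, p. 1634], with the local conditions at primes `v ∣ p` … replaced by …
`H¹_±(K_v, T_j)` … [CW24, Def. 4.6]. In particular, at the primes `q ∤ N⁻mp`, the classes … are
unramified …, while at the primes `q ∣ N⁻m` they are required to land in … `H¹_ord(K_q, T_j)`";
[Howard2006] §3.1: "`𝒮_𝔫(D_∞, E[p^k]) ⊂ lim←_m H¹(D_m, E[p^k])` … the `Λ`-submodule of classes which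
are ordinary at the primes dividing `𝔫pN⁻`, and unramified at all other primes" (levelwise conditions
on the tower, the model typed here). [cite: CastellaEtAl2025, §7.2 (arXiv:2308.10474v2 p0030 L16–L27)]
[cite: Howard2006, §3.1 (the modules 𝒮_𝔫(D_∞, E[p^k]))] [cite: BurungaleCastellaKim2021, §2 (journal p. 1634) = arXiv:1908.09512 §7 (the Selmer group Sel^{m-ord})] -/
def signedOrdSelmerTorsion (ε : ℤˣ) (m n j : ℕ) :
    AddSubgroup (W.torsionH1Over ((p : ℤ) ^ j) (κ.layerSubgroup n)) :=
  (⨅ (v : HeightOneSpectrum (𝓞 K)) (_ : ((p : ℕ) : 𝓞 K) ∈ v.asIdeal),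
      condAboveTorsion W p κ v (.sgn ε) n j) ⊓
    (⨅ (v : HeightOneSpectrum (𝓞 K)) (_ : ((p : ℕ) : 𝓞 K) ∉ v.asIdeal)
      (_ : ∃ ℓ : ℕ, ℓ.Prime ∧ ℓ ∣ m ∧ ((ℓ : ℕ) : 𝓞 K) ∈ v.asIdeal)
      (𝔓 : Ideal (absIntegers (𝓞 K) K)) (_ : 𝔓 ∈ v.primesAbove),
      ordinaryAt W ((p : ℤ) ^ j) (κ.layerSubgroup n) 𝔓) ⊓
    ⨅ (v : HeightOneSpectrum (𝓞 K)) (_ : ((p : ℕ) : 𝓞 K) ∉ v.asIdeal)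
      (_ : ¬ ∃ ℓ : ℕ, ℓ.Prime ∧ ℓ ∣ m ∧ ((ℓ : ℕ) : 𝓞 K) ∈ v.asIdeal)
      (𝔓 : Ideal (absIntegers (𝓞 K) K)) (_ : 𝔓 ∈ v.primesAbove),
      unramifiedAt W ((p : ℤ) ^ j) (κ.layerSubgroup n) 𝔓

variable {W p κ} in
/-- Membership in `Sel^ε_m(K_n, E[p^j])` (unfolding the three blocks of conditions).
[cite: CastellaEtAl2025, §7.2 (arXiv:2308.10474v2 p0030 L16–L27)] -/
theorem mem_signedOrdSelmerTorsion_iff {ε : ℤˣ} {m n j : ℕ}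
    (c : W.torsionH1Over ((p : ℤ) ^ j) (κ.layerSubgroup n)) :
    c ∈ signedOrdSelmerTorsion W p κ ε m n j ↔
      (∀ v : HeightOneSpectrum (𝓞 K), ((p : ℕ) : 𝓞 K) ∈ v.asIdeal →
        c ∈ condAboveTorsion W p κ v (.sgn ε) n j) ∧
      (∀ v : HeightOneSpectrum (𝓞 K), ((p : ℕ) : 𝓞 K) ∉ v.asIdeal →
        (∃ ℓ : ℕ, ℓ.Prime ∧ ℓ ∣ m ∧ ((ℓ : ℕ) : 𝓞 K) ∈ v.asIdeal) →
        ∀ 𝔓 ∈ v.primesAbove, c ∈ ordinaryAt W ((p : ℤ) ^ j) (κ.layerSubgroup n) 𝔓) ∧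
      (∀ v : HeightOneSpectrum (𝓞 K), ((p : ℕ) : 𝓞 K) ∉ v.asIdeal →
        (¬ ∃ ℓ : ℕ, ℓ.Prime ∧ ℓ ∣ m ∧ ((ℓ : ℕ) : 𝓞 K) ∈ v.asIdeal) →
        ∀ 𝔓 ∈ v.primesAbove, c ∈ unramifiedAt W ((p : ℤ) ^ j) (κ.layerSubgroup n) 𝔓) := by
  simp only [signedOrdSelmerTorsion, AddSubgroup.mem_inf, AddSubgroup.mem_iInf, and_assoc]

/-- **`Sel^ε_m(K, T_j) := lim←_n Sel^ε_m(K_n, E[p^j])`** — the source's `Sel±_{N⁻m}(K, T_j)` for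
`N⁻ = 1` (= [Howard2006]'s `𝒮_𝔫(D_∞, E[p^k])`, `𝔫 = m𝓞_K`, with the `±` condition above `p`): the
norm-compatible families with level conditions `signedOrdSelmerTorsion … ε m n j`.  The home of the
classes `κ±_j(m)`, `m ∈ 𝒩_j^ind`. [cite: CastellaEtAl2025, Thm. 7.4 and §7.2 (arXiv:2308.10474v2 p0030)]
[cite: Howard2006, §3.1–3.2] -/
def signedOrdSelmer (ε : ℤˣ) (m j : ℕ) :
    AddSubgroup (Π n : ℕ, W.torsionH1Over ((p : ℤ) ^ j) (κ.layerSubgroup n)) :=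
  levelAdic W p κ γ j fun n ↦ signedOrdSelmerTorsion W p κ ε m n j

variable {W p κ γ} in
/-- Membership in `Sel^ε_m(K, T_j)`: levelwise in `Sel^ε_m(K_n, E[p^j])` and norm-compatible
(unfolding; the Selmer families are monotone along any levelwise inclusion of conditions,
`levelAdic_mono`). [cite: Howard2006, §3.1] -/
theorem mem_signedOrdSelmer_iff {ε : ℤˣ} {m j : ℕ}
    (x : Π n : ℕ, W.torsionH1Over ((p : ℤ) ^ j) (κ.layerSubgroup n)) :
    x ∈ signedOrdSelmer W p κ γ ε m j ↔ (∀ n, x n ∈ signedOrdSelmerTorsion W p κ ε m n j) ∧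
      ∀ n, resOfLe (geomTorsion W ((p : ℤ) ^ j)) (κ.layerSubgroup_antitone (Nat.le_succ n)) (x n) =
        ∑ i ∈ Finset.range p,
          conjH1 (κ.layerSubgroup (n + 1)) (geomTorsion W ((p : ℤ) ^ j)) (γ ^ (p ^ n * i)) (x (n + 1)) :=
  Iff.rfl

end Selmer

/-! ## Part 4. The local `Λ`-adic targets at a prime split completely in `K_∞`: coinduced families,
the raw truncated `Λ`-action, the coordinate families `unrLoc` / `ordLoc`, and reciprocity laws as
equalities of lines -/

section Coinduced

variable (p : ℕ) {U : Type*} [AddCommGroup U]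

/-- **Coinduced (trace-compatible) families with values in `B ≤ U`**: `u = (u_n : ℤ/p^n → U)_n` with
`u_n(a) ∈ B` and `u_n(a) = Σ_{i<p} u_{n+1}(ã + pⁿ i)` (`ã` the standard lift), i.e. an element of
`lim←_n B[Γ/Γ^{pⁿ}] = B ⊗ Λ` — the shape of [Howard2006, Lem. 3.1.2]'s `lim←_m ⊕_{w∣𝔩} H¹_?(D_{m,w}, E[p^k])
≅ H¹_?(K_𝔩, E[p^k]) ⊗ Λ` for a prime `𝔩` split completely in `D_∞` (places of `D_m` above `𝔩` ↔
`Γ/Γ^{p^m}`; flag `coinduced`).  A predicate on raw families; nothing asserted.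
[cite: Howard2006, Lem. 3.1.2 (and its proof)] -/
def IsCoinducedIn (B : AddSubgroup U) (u : Π n : ℕ, ZMod (p ^ n) → U) : Prop :=
  (∀ n a, u n a ∈ B) ∧
    ∀ (n : ℕ) (a : ZMod (p ^ n)),
      u n a = ∑ i ∈ Finset.range p, u (n + 1) ((a.val + p ^ n * i : ℕ) : ZMod (p ^ (n + 1)))

/-- The translation `(s u)(a) = u(a − 1)` on `U`-valued functions on `ℤ/p^n` — the action of the
generator `γ` of `Γ/Γ^{pⁿ}` on `U[Γ/Γ^{pⁿ}]`. [cite: Howard2006, Lem. 3.1.2 (proof: H¹(K_𝔩, E[p^k]) ⊗ Λ)] -/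
def coShift (n : ℕ) : AddMonoid.End (ZMod (p ^ n) → U) where
  toFun u := fun a ↦ u (a - 1)
  map_zero' := rfl
  map_add' _ _ := rfl

/-- Unfolding `coShift`. [cite: Howard2006, Lem. 3.1.2] -/
@[simp] theorem coShift_apply (n : ℕ) (u : ZMod (p ^ n) → U) (a : ZMod (p ^ n)) :
    coShift p n u a = u (a - 1) :=
  rfl

/-- `ψ_n = γ − 1` on `U[Γ/Γ^{pⁿ}]` (translation minus identity) — the operator through which
`T ∈ Λ = ℤ_p⟦T⟧`, `T = γ − 1`, acts (as the tree's `AcSigned.psi = conj_γ − 1` on global classes).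
[cite: CastellaWan2023, §4.1 (MS p. 19, "Y = γ^ac − 1")] [cite: Howard2006, Lem. 3.1.2] -/
def coPsi (n : ℕ) : AddMonoid.End (ZMod (p ^ n) → U) :=
  coShift p n - 1

/-- Unfolding `coPsi`. [cite: Howard2006, Lem. 3.1.2] -/
theorem coPsi_apply (n : ℕ) (u : ZMod (p ^ n) → U) (a : ZMod (p ^ n)) :
    coPsi p n u a = u (a - 1) - u a := by
  rw [coPsi, End_sub_apply, AddMonoid.End.one_apply, Pi.sub_apply, coShift_apply]

variable [Fact p.Prime]

/-- **The raw truncated `Λ = ℤ_p⟦T⟧`-action on families**: on the level-`n` component, `f` acts by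
`Σ_{i < j pⁿ} coeff_i(f) (γ − 1)^i` with coefficients through `ℤ_p → ℤ/p^j` (the tree's
`IwasawaDual.evalT`) — the SAME formula as the tree's `AcSigned.tsmul` on global families (there
`γ − 1 = conj_γ − 1`, here `γ − 1 = coPsi`), legitimate on `p^j`-torsion-valued families since
`(γ − 1)^{j pⁿ} = 0` on `(U[p^j])[Γ/Γ^{pⁿ}]`.  A raw function; no module structure is asserted.
[cite: CastellaWan2023, §4.1 (MS p. 19)] [cite: Lang1990, Ch. 5 §1 Thm. 1.1] -/
def coTsmul (j : ℕ) (f : IwasawaAlgebra p) (u : Π n : ℕ, ZMod (p ^ n) → U) :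
    Π n : ℕ, ZMod (p ^ n) → U :=
  fun n ↦ evalT p (coPsi p n) (j * p ^ n) j f (AddMonoidHom.id _) (u n)

/-- Unfolding `coTsmul` (definitional). [cite: Lang1990, Ch. 5 §1 Thm. 1.1] -/
theorem coTsmul_apply (j : ℕ) (f : IwasawaAlgebra p) (u : Π n : ℕ, ZMod (p ^ n) → U) (n : ℕ) :
    coTsmul p j f u n = evalT p (coPsi p n) (j * p ^ n) j f (AddMonoidHom.id _) (u n) :=
  rfl

/-- **"`Λ·x = λ·M`"** for a raw family `x`, a (lift of an) element `λ ∈ Λ/p^jΛ` and a family of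
families `M` (intended: the coinduced families with values in a line, a free `Λ/p^jΛ`-module of rank one
under `coTsmul`): `x ∈ λ·M` and `λ·M ⊆ Λ·x`.  For `M` free of rank one over the LOCAL ring `Λ/p^jΛ`
this is EQUIVALENT to [Howard2006]'s "there is an isomorphism of `Λ`-modules `M ≅ Λ/p^kΛ` taking `x` to
`λ`" and to the source's "`x = λ` under a fixed isomorphism `M ≃ Λ/p^jΛ`" up to `(Λ/p^jΛ)^×` (flag
`law-as-lines`: `Λx = λM ⟺ x = uλe`, `e` a generator, `u` a unit). A predicate; nothing asserted.
[cite: Howard2006, Def. 2.3.2 and §3.2 (15)] [cite: CastellaEtAl2025, Thm. 7.4 (arXiv:2308.10474v2 p0030 L44–L52)] -/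
def SpanEqSmul (j : ℕ) (lam : IwasawaAlgebra p) (x : Π n : ℕ, ZMod (p ^ n) → U)
    (M : (Π n : ℕ, ZMod (p ^ n) → U) → Prop) : Prop :=
  (∃ y, M y ∧ x = coTsmul p j lam y) ∧
    ∀ y, M y → ∃ f : IwasawaAlgebra p, coTsmul p j lam y = coTsmul p j f x

end Coinduced

section LocalCoordinates

variable {K : Type u} [Field K] (W : WeierstrassCurve K) (p : ℕ) [Fact p.Prime]
  (κ : ZpExtension K p) (γ : absoluteGaloisGroup K) (j : ℕ)

/-- **The unramified coordinate family of a global family at a Frobenius `φ`** (of a prime `𝔓` of `K̄`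
over `𝔮` split completely in `K_∞`, so `φ ∈ Gal(K̄/K_∞) = ker κ` — the hypothesis `hφ`): for
`x = (x_n) ∈ ∏_n H¹(K_n, E[p^j])`, the family `a ↦ res_{⟨φ⟩}(conj_{γ^a}⁻¹ x_n) ∈ H¹(⟨φ⟩, E[p^j])`,
`a ∈ ℤ/p^n` — the components of `loc_𝔮(x) ∈ lim_n ⊕_{w∣𝔮} H¹(K_{n,w}, E[p^j]) = H¹(K_𝔮, E[p^j]) ⊗ Λ`
([Howard2006, Lem. 3.1.2]) at the `Γ/Γ^{pⁿ}`-translates of the place under `𝔓`, read in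
`H¹(⟨Frob⟩, E[p^j]) ≅ E[p^j]/(Frob − 1)` by "evaluation of cocycles at `Frob_𝔩`", which is an
isomorphism on `H¹_unr` and kills `H¹_ord` ([Howard2006, Lem. 2.2.1, proof]; flags `coinduced`,
`ord-via-Frobenius`, `index-convention`).  The target of the SECOND reciprocity law
("`loc_q(κ±_j(m)) = λ±_j(mq)` under a fixed isomorphism `H¹_unr(K_q, T_j) ≃ Λ/p^jΛ`"). A raw function.
[cite: CastellaEtAl2025, Thm. 7.4, second law (arXiv:2308.10474v2 p0030 L50–L52)]
[cite: Howard2006, Lem. 2.2.1 (proof) and Lem. 3.1.2] -/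
def unrLoc {φ : absoluteGaloisGroup K} (hφ : φ ∈ κ.kerSubgroup)
    (x : Π n : ℕ, W.torsionH1Over ((p : ℤ) ^ j) (κ.layerSubgroup n)) :
    Π n : ℕ, ZMod (p ^ n) → subgroupH1 (Subgroup.zpowers φ) (geomTorsion W ((p : ℤ) ^ j)) :=
  fun n a ↦ resOfLe (geomTorsion W ((p : ℤ) ^ j))
    ((Subgroup.zpowers_le.mpr hφ).trans (κ.kerSubgroup_le_layerSubgroup n))
    (conjH1 (κ.layerSubgroup n) (geomTorsion W ((p : ℤ) ^ j)) (γ ^ a.val)⁻¹ (x n))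

/-- **The ordinary (inertial) coordinate family of a global family at a prime `𝔓` of `K̄`** (over `𝔮`
split completely and unramified in `K_∞`, so `I_𝔓 ⊆ Gal(K̄/K_∞)`; the intersection with `ker κ` keeps the
definition hypothesis-free): `a ↦ res_{I_𝔓 ∩ Gal(K̄/K_∞)}(conj_{γ^a}⁻¹ x_n) ∈ H¹(I_𝔓 ∩ Gal(K̄/K_∞), E[p^j])`.
Restriction to inertia kills exactly `H¹_unr` and embeds `H¹_ord(K_𝔮, E[p^j]) = im H¹(K_𝔮, μ_{p^j})`
(for admissible `q`, `H¹_unr(K_𝔮, μ_{p^j}) = μ_{p^j}/(q² − 1) = 0`; "`H¹_ord(K_𝔩, T) ≅ H¹(K_𝔩, R(1)) ≅ R`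
by local Kummer theory", [Howard2006, Lem. 2.2.1]), onto the line `ordLine` below.  The target of the
FIRST reciprocity law ("`loc_{q₂}(κ±_j(mq₁q₂)) = λ±_j(mq₁)` under a fixed isomorphism `H¹_ord(K_{q₂}, T_j)
≃ Λ/p^jΛ`"; flag `law-typo`). A raw function. [cite: CastellaEtAl2025, Thm. 7.4, first law (arXiv:2308.10474v2 p0030 L46–L49)]
[cite: Howard2006, §2.2 and Lem. 2.2.1, Lem. 3.1.2] -/
def ordLoc (𝔓 : Ideal (absIntegers (𝓞 K) K))
    (x : Π n : ℕ, W.torsionH1Over ((p : ℤ) ^ j) (κ.layerSubgroup n)) :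
    Π n : ℕ, ZMod (p ^ n) →
      subgroupH1 (𝔓.inertia (absoluteGaloisGroup K) ⊓ κ.kerSubgroup) (geomTorsion W ((p : ℤ) ^ j)) :=
  fun n a ↦ resOfLe (geomTorsion W ((p : ℤ) ^ j))
    (inf_le_right.trans (κ.kerSubgroup_le_layerSubgroup n))
    (conjH1 (κ.layerSubgroup n) (geomTorsion W ((p : ℤ) ^ j)) (γ ^ a.val)⁻¹ (x n))

/-- **The ordinary line in `H¹(I_𝔓 ∩ Gal(K̄/K_∞), E[p^j])`**: the restrictions of the classes of the
local group `D_𝔓 ∩ Gal(K̄/K_∞)` (`= D_𝔓 = Gal(K̄_𝔮/K_𝔮)` for `𝔮` split completely in `K_∞`) — the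
image of `H¹(K_𝔮, E[p^j]) → H¹(I_𝔮, E[p^j])`, which is `H¹_ord(K_𝔮, E[p^j]) ≅ ℤ/p^j` for admissible `q`
([Howard2006, Lem. 2.2.1]); the coinduced families with values in it model `H¹_ord(K_𝔮, T_j) =
H¹_ord(K_𝔮, E[p^j]) ⊗ Λ/p^j`, "free of rank `1` over `Λ/p^jΛ` (see e.g. [BCK21, Lem. 2.1])".
[cite: CastellaEtAl2025, §7.2 (arXiv:2308.10474v2 p0030 L24–L27)] [cite: Howard2006, Lem. 2.2.1 and Lem. 3.1.2] -/
def ordLine (𝔓 : Ideal (absIntegers (𝓞 K) K)) :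
    AddSubgroup (subgroupH1 (𝔓.inertia (absoluteGaloisGroup K) ⊓ κ.kerSubgroup)
      (geomTorsion W ((p : ℤ) ^ j))) :=
  (resOfLe (geomTorsion W ((p : ℤ) ^ j))
    (inf_le_inf_right κ.kerSubgroup (𝔓.inertia_le_decompositionSubgroup (absoluteGaloisGroup K)) :
      𝔓.inertia (absoluteGaloisGroup K) ⊓ κ.kerSubgroup ≤
        𝔓.decompositionSubgroup (absoluteGaloisGroup K) ⊓ κ.kerSubgroup)).range

variable {W p κ γ j}

/-- Unfolding `unrLoc` (definitional). [cite: Howard2006, Lem. 3.1.2] -/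
theorem unrLoc_apply {φ : absoluteGaloisGroup K} (hφ : φ ∈ κ.kerSubgroup)
    (x : Π n : ℕ, W.torsionH1Over ((p : ℤ) ^ j) (κ.layerSubgroup n)) (n : ℕ) (a : ZMod (p ^ n)) :
    unrLoc W p κ γ j hφ x n a = resOfLe (geomTorsion W ((p : ℤ) ^ j))
      ((Subgroup.zpowers_le.mpr hφ).trans (κ.kerSubgroup_le_layerSubgroup n))
      (conjH1 (κ.layerSubgroup n) (geomTorsion W ((p : ℤ) ^ j)) (γ ^ a.val)⁻¹ (x n)) :=
  rfl

/-- Unfolding `ordLoc` (definitional). [cite: Howard2006, Lem. 3.1.2] -/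
theorem ordLoc_apply (𝔓 : Ideal (absIntegers (𝓞 K) K))
    (x : Π n : ℕ, W.torsionH1Over ((p : ℤ) ^ j) (κ.layerSubgroup n)) (n : ℕ) (a : ZMod (p ^ n)) :
    ordLoc W p κ γ j 𝔓 x n a = resOfLe (geomTorsion W ((p : ℤ) ^ j))
      (inf_le_right.trans (κ.kerSubgroup_le_layerSubgroup n))
      (conjH1 (κ.layerSubgroup n) (geomTorsion W ((p : ℤ) ^ j)) (γ ^ a.val)⁻¹ (x n)) :=
  rfl

end LocalCoordinates

/-! ## Part 5. Signed bipartite systems (data; the laws and memberships as a `Prop` structure) -/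

section System

variable (W : WeierstrassCurve ℚ) (K : Type) [Field K] [NumberField K] (p : ℕ) [Fact p.Prime]
  (κ : ZpExtension K p)

/-- **The raw data of a (signed, `Λ`-adic) bipartite system for `E/K`**: for every `j` and `m`, a family
`kappa j m = (κ_j(m)_n)_n ∈ ∏_n H¹(K_n, E[p^j])` (meaningful for `j > 0`, `m ∈ 𝒩_j^ind`) and an element
`lam j m ∈ Λ = ℤ_p⟦T⟧` lifting `λ_j(m) ∈ Λ/p^jΛ` (meaningful for `m ∈ 𝒩_j^def`; flag `lambda-lift`).
Printed: "a pair of systems `κ±_j = {κ±_j(m) ∈ Sel±_{N⁻m}(K, T_j) : m ∈ 𝒩_j^ind}`, `λ±_j = {λ±_j(m) ∈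
Λ/℘^jΛ : m ∈ 𝒩_j^def}`"; [Howard2006] (15).  The memberships and laws are the `Prop`-structure
`IsSignedBipartiteSystem`. [cite: CastellaEtAl2025, Thm. 7.4 (arXiv:2308.10474v2 p0030 L37–L43)]
[cite: Howard2006, §3.2 (15)] -/
structure SignedBipartiteSystem where
  /-- The classes `κ_j(m) = (κ_j(m)_n)_n ∈ ∏_n H¹(K_n, E[p^j])`. -/
  kappa : (j : ℕ) → ℕ → Π n : ℕ, (W.baseChange K).torsionH1Over ((p : ℤ) ^ j) (κ.layerSubgroup n)
  /-- Lifts to `Λ` of the elements `λ_j(m) ∈ Λ/p^jΛ`. -/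
  lam : ℕ → ℕ → IwasawaAlgebra p

variable {W K p κ}

/-- **`z` is the limit base class of the system `B`**: `z_{n,j} = κ_j(1)_n` for all `n` and all
`j > 0`, for a two-index family `z ∈ ∏_n ∏_j H¹(K_n, E[p^j])` (the carrier of the tree's
`AcSigned.selmerLambdaAdic`).  Printed (7.2): "For `m = 1`, the classes `κ±_j := κ±_j(1)` exist for all
`j > 0` and are compatible …, thereby defining the class `lim←_j κ±_j ∈ Sel±_{N⁻}(K, T) :=
lim←_j Sel±_{N⁻}(K, T_j)`", with "`𝒮_± ≃ lim←_j Sel±_{N⁻}(K, T_j)`" [p0031 L1] ([Howard2006] (16): the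
"distinguished element `κ^∞ ∈ 𝒮`"). A predicate; nothing asserted.
[cite: CastellaEtAl2025, (7.2) (arXiv:2308.10474v2 p0030 L57–L62, p0031 L1–L8)] [cite: Howard2006, §3.2 (16)] -/
def SignedBipartiteSystem.IsLimitBaseClass (B : SignedBipartiteSystem W K p κ)
    (z : Π n j : ℕ, (W.baseChange K).torsionH1Over ((p : ℤ) ^ j) (κ.layerSubgroup n)) : Prop :=
  ∀ n j : ℕ, 0 < j → z n j = B.kappa j 1 n

/-- Unfolding `IsLimitBaseClass`. [cite: CastellaEtAl2025, (7.2) (arXiv:2308.10474v2 p0030 L57–L62)] -/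
theorem SignedBipartiteSystem.isLimitBaseClass_iff (B : SignedBipartiteSystem W K p κ)
    (z : Π n j : ℕ, (W.baseChange K).torsionH1Over ((p : ℤ) ^ j) (κ.layerSubgroup n)) :
    B.IsLimitBaseClass z ↔ ∀ n j : ℕ, 0 < j → z n j = B.kappa j 1 n :=
  Iff.rfl

variable [W.IsGloballyMinimal]

/-- **The non-vanishing criterion of Thm. 7.5 for the system `B`** (the statement [NV] of the consumer):
"for some `j > 0` there exists `m ∈ 𝒩_j^def` such that `λ±_j(m)` has non-zero image under the map
`Λ/p^jΛ → Λ/𝔪Λ ≃ 𝔽_p`" — for `Λ = ℤ_p⟦T⟧`, `𝔪 = (p, T)`, the map is `f ↦ f(0) mod p`, so: the constant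
coefficient of (any lift of) `λ_j(m)` is a unit of `ℤ_p` (flag `lambda-lift`: `p^jΛ ⊆ 𝔪` for `j > 0`).
[cite: CastellaEtAl2025, Thm. 7.5 (arXiv:2308.10474v2 p0031 L17–L20)] [cite: Howard2006, Thm. 3.2.3 (c)] -/
def SignedBipartiteSystem.HasUnitLambda (B : SignedBipartiteSystem W K p κ) (N : ℕ) : Prop :=
  ∃ j : ℕ, 0 < j ∧ ∃ m ∈ defProducts N K (fun ℓ ↦ W.frobeniusTrace ℓ) p j,
    IsUnit (PowerSeries.constantCoeff (B.lam j m))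

/-- Unfolding `HasUnitLambda`. [cite: CastellaEtAl2025, Thm. 7.5 (arXiv:2308.10474v2 p0031 L17–L20)] -/
theorem SignedBipartiteSystem.hasUnitLambda_iff (B : SignedBipartiteSystem W K p κ) (N : ℕ) :
    B.HasUnitLambda N ↔ ∃ j : ℕ, 0 < j ∧ ∃ m ∈ defProducts N K (fun ℓ ↦ W.frobeniusTrace ℓ) p j,
      IsUnit (PowerSeries.constantCoeff (B.lam j m)) :=
  Iff.rfl

variable (W K p κ) (γ : absoluteGaloisGroup K)

/-- **`B` is a signed bipartite Euler system of sign `ε` for `(E, K, p)` at level `N`** (`N = N_E`,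
`N⁻ = 1`; admissibility relative to `f_E`: `a_ℓ = W.frobeniusTrace ℓ` on the global minimal model) — the
conjunction of the printed properties of the pair of systems of Thm. 7.4, in [Howard2006]'s `Λ`-adic
form §3.2 (15) with "the ordinary Selmer condition at the primes above `p` replaced by the `±`-condition"
(the source, proof of Thm. 7.5), field by field:
* `kappa_mem` — "`κ±_j(m) ∈ Sel±_{N⁻m}(K, T_j)`, `m ∈ 𝒩_j^ind`" ↦ `B.kappa j m ∈ signedOrdSelmer (W⁄K) p κ γ ε m j`;
* `kappa_compat`, `lam_compat` — "compatible with the inclusion `𝒩_{k+1} ⊂ 𝒩_k` and the natural maps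
  `Λ/p^{k+1}Λ → Λ/p^kΛ` and `E[p^{k+1}] →^p E[p^k]`" ([Howard2006] (15); the source displays it for
  `m = 1` — flag `compat-all-m`) ↦ `p_* κ_{j+1}(m) = κ_j(m)` levelwise (`reduceTorsionH1`) and
  `λ_{j+1}(m) − λ_j(m) ∈ p^jΛ`;
* `first_law` — "If `mq₁q₂ ∈ 𝒩_j^ind` … `loc_{q₂}(κ±_j(mq₁q₂)) = λ±_j(mq₁)` under a fixed isomorphism
  `H¹_ord(K_{q₂}, T_j) ≃ Λ/p^jΛ`" ([Howard2006]: "for any `𝔫𝔩 ∈ 𝒩_k^indefinite` there is an isomorphism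
  of `Λ`-modules `lim←_m H¹_ord(D_{m,𝔩}, E[p^k]) ≅ Λ/p^kΛ` taking `loc_𝔩(κ_{𝔫𝔩})` to `λ_𝔫`"; flag
  `law-typo`) ↦ for `nq ∈ 𝒩_j^ind`, `q ∈ 𝓛_j`, `q ∤ n`, at every prime `𝔓` of `K̄` above `q`:
  `Λ·ordLoc_𝔓(κ_j(nq)) = λ_j(n)·{coinduced families in ordLine 𝔓}` (`SpanEqSmul`; flag `law-as-lines`);
* `second_law` — "If `mq ∈ 𝒩_j^def` with `q ∈ 𝓛_j` prime, then `loc_q(κ±_j(m)) = λ±_j(mq)` under a fixed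
  isomorphism `H¹_unr(K_q, T_j) ≃ Λ/p^jΛ`" ↦ for `mq ∈ 𝒩_j^def`, `q ∈ 𝓛_j`, `q ∤ m`, at every `𝔓` above
  `q` and every Frobenius `φ ∈ D_𝔓 ∩ Gal(K̄/K_∞)` of `𝔓/K`: `Λ·unrLoc_φ(κ_j(m)) = λ_j(mq)·{all coinduced
  families in H¹(⟨φ⟩, E[p^j])}`.
A `Prop`-valued structure; nothing is asserted. [cite: CastellaEtAl2025, Thm. 7.4 (arXiv:2308.10474v2 p0030 L29–L62)]
[cite: Howard2006, §3.2 (15)] [cite: BurungaleCastellaKim2021, arXiv:1908.09512 §7 (pp. 12–13; journal §2, p. 1634)] -/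
structure IsSignedBipartiteSystem (N : ℕ) (ε : ℤˣ) (B : SignedBipartiteSystem W K p κ) : Prop where
  /-- `κ_j(m) ∈ Sel^ε_m(K, T_j)` for `j > 0`, `m ∈ 𝒩_j^ind`. -/
  kappa_mem : ∀ j m : ℕ, 0 < j → m ∈ indefProducts N K (fun ℓ ↦ W.frobeniusTrace ℓ) p j →
    B.kappa j m ∈ signedOrdSelmer (W.baseChange K) p κ γ ε m j
  /-- `p_* κ_{j+1}(m) = κ_j(m)` (levelwise) for `m ∈ 𝒩_{j+1}^ind`. -/
  kappa_compat : ∀ j m n : ℕ, 0 < j → m ∈ indefProducts N K (fun ℓ ↦ W.frobeniusTrace ℓ) p (j + 1) →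
    (W.baseChange K).reduceTorsionH1 p j (κ.layerSubgroup n) (B.kappa (j + 1) m n) = B.kappa j m n
  /-- `λ_{j+1}(m) ≡ λ_j(m) (mod p^j)` for `m ∈ 𝒩_{j+1}^def`. -/
  lam_compat : ∀ j m : ℕ, 0 < j → m ∈ defProducts N K (fun ℓ ↦ W.frobeniusTrace ℓ) p (j + 1) →
    B.lam (j + 1) m - B.lam j m ∈ Ideal.span {PowerSeries.C ((p : ℤ_[p]) ^ j)}
  /-- First reciprocity law: `loc_q(κ_j(nq))` generates `λ_j(n) · H¹_ord(K_q, T_j)` (`nq ∈ 𝒩_j^ind`). -/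
  first_law : ∀ j n q : ℕ, 0 < j → n * q ∈ indefProducts N K (fun ℓ ↦ W.frobeniusTrace ℓ) p j →
    IsAdmissiblePrime N K (fun ℓ ↦ W.frobeniusTrace ℓ) p j q → ¬ q ∣ n →
    ∀ (v : HeightOneSpectrum (𝓞 K)), ((q : ℕ) : 𝓞 K) ∈ v.asIdeal →
      ∀ 𝔓 ∈ v.primesAbove,
        SpanEqSmul p j (B.lam j n) (ordLoc (W.baseChange K) p κ γ j 𝔓 (B.kappa j (n * q)))
          (IsCoinducedIn p (ordLine (W.baseChange K) p κ j 𝔓))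
  /-- Second reciprocity law: `loc_q(κ_j(m))` generates `λ_j(mq) · H¹_unr(K_q, T_j)` (`mq ∈ 𝒩_j^def`). -/
  second_law : ∀ j m q : ℕ, 0 < j → m * q ∈ defProducts N K (fun ℓ ↦ W.frobeniusTrace ℓ) p j →
    IsAdmissiblePrime N K (fun ℓ ↦ W.frobeniusTrace ℓ) p j q → ¬ q ∣ m →
    ∀ (v : HeightOneSpectrum (𝓞 K)), ((q : ℕ) : 𝓞 K) ∈ v.asIdeal →
      ∀ 𝔓 ∈ v.primesAbove, ∀ (φ : absoluteGaloisGroup K) (hφ : φ ∈ κ.kerSubgroup),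
        φ ∈ 𝔓.decompositionSubgroup (absoluteGaloisGroup K) → IsArithFrobAt (𝓞 K) φ 𝔓 →
        SpanEqSmul p j (B.lam j (m * q)) (unrLoc (W.baseChange K) p κ γ j hφ (B.kappa j m))
          (IsCoinducedIn p ⊤)

end System

/-! ## Part 6. The two printed theorems (named facts; statements only, hypotheses as printed,
restricted as documented: (R1)–(R6)) -/

section Facts

variable (N : ℕ) [NeZero N] (W : WeierstrassCurve ℚ) [W.IsGloballyMinimal] (K : Type) [Field K]
  [NumberField K] (p : ℕ) [Fact p.Prime] (κ : ZpExtension K p) (𝔭 𝔭' : HeightOneSpectrum (𝓞 K))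
  (jbar : AlgebraicClosure K →+* ℂ)

/-- **Castella–Hsu–Kundu–Lee–Liu 2025, Thm. 7.4 (Darmon–Iovita, Pollack–Weston) with (7.2): existence
of the signed bipartite Euler system through the signed `Λ`-adic Heegner class.**  Printed: "Suppose
that (i) `a_p(E) = 0`. (ii) `p` splits in `K`. (iii) Each prime above `p` is totally ramified in `K_∞/K`.
(iv) `(ρ̄, N⁻)` satisfies Condition CR. Then for every choice of sign `±` and every `j > 0` there is a
pair of systems `κ±_j = {κ±_j(m) ∈ Sel±_{N⁻m}(K, T_j) : m ∈ 𝒩_j^ind}`, `λ±_j = {λ±_j(m) ∈ Λ/℘^jΛ :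
m ∈ 𝒩_j^def}`, related by a system of "explicit reciprocity laws" [the two laws]", "For `m = 1`, the
classes `κ±_j := κ±_j(1)` exist for all `j > 0` and are compatible …, thereby defining the class (7.2)
`lim←_j κ±_j ∈ Sel±_{N⁻}(K, T)`", "`𝒮_± ≃ lim←_j Sel±_{N⁻}(K, T_j)` … (7.2) is the same as the class `κ±_∞`
in (7.1)", `κ±_∞` "constructed in [CW24, §4.1] (where it is denoted `z^±_∞ = cor_{K[1]/K}(z_∞[1]^±)`)";
proof "[DI08] … [PW11, §4.3]" (flag `CHKLL-inputs`).  Standing §7.1: `E/ℚ` of conductor `N`, `p > 2`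
good supersingular, `K` imaginary quadratic of discriminant prime to `N`, (spl), (gen-Heeg).
TRANSCRIBED (module docstring (R1)–(R4), READINGS): `AcSigned.Setting W K p κ 𝔭 𝔭'` ((i), (ii),
`p ∤ h_K` for (iii), `κ` anticyclotomic), `5 ≤ p` (R1), `N = N_E`, `N⁻ = 1` (`SatisfiesHeegnerHypothesis
N K`, (R2)), `(N, D_K) = 1`, CR = `Rank1Residual.Surj W p` (R4); for every topological generator `γ`,
every trace-coherent Heegner family `F` of level `N` (flag `heegner-family`) and every sign `ε`: THERE
IS a system `B` with `IsSignedBipartiteSystem (W) K p κ γ N ε B` whose limit base class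
(`B.IsLimitBaseClass z`: `z_{n,j} = κ_j(1)_n`) is an element `z` of the tree's `𝒮_ε =
AcSigned.selmerLambdaAdic (W⁄K) p κ γ (sgn ε)` (the source's `𝒮_± ≃ lim_j Sel±_{N⁻}(K, T_j)`; flag
`away-p-unr`) which IS the `ε`-signed Heegner class of `F` (`AcSigned.IsSignedHeegnerClass p κ γ F ε z`,
Castella–Wan Def. 4.5 as pinned by the sibling file).  WEAKER than print, never stronger; no `_holds`
expected. [cite: CastellaEtAl2025, Thm. 7.4, (7.2) and §7.1–7.2 (arXiv:2308.10474v2 p0029 L3–L51, p0030 L29–L62, p0031 L1–L12)]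
[cite: Howard2006, §3.2 (15)–(16)] [cite: CastellaWan2023, Prop. 4.4, Def. 4.5 and §4.2 (MS pp. 20–22)] -/
def thm74_exists_signedBipartiteSystem : Prop :=
  ∀ (_ : Setting W K p κ 𝔭 𝔭'), (W.conductorNorm ℤ : ℕ) = N → SatisfiesHeegnerHypothesis N K →
    IsCoprime (N : ℤ) (NumberField.discr K) → 5 ≤ p → Rank1Residual.Surj W p →
    ∀ (γ : absoluteGaloisGroup K), κ.IsTopGenerator γ →
    ∀ (F : HeegnerFamily N W K κ jbar), F.IsTraceCoherentApZero → ∀ ε : ℤˣ,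
      ∃ B : SignedBipartiteSystem W K p κ, IsSignedBipartiteSystem W K p κ γ N ε B ∧
        ∃ z ∈ selmerLambdaAdic (W.baseChange K) p κ γ (fun _ ↦ .sgn ε),
          B.IsLimitBaseClass z ∧ IsSignedHeegnerClass p κ γ F ε z

/-- **Castella–Hsu–Kundu–Lee–Liu 2025, Thm. 7.5 (Howard): `Λ`-rank one, the Howard divisibility
`Char_Λ(𝒳^±_tors) ⊃ Char_Λ(𝒮_±/(κ±_∞))²`, and EQUALITY when some `λ±_j(m)` is non-zero modulo `𝔪`.**
Printed: "Let the notations and hypotheses be as in Theorem 7.4. Then both `𝒮_±` and `𝒳_±` have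
`Λ`-rank one, and the following divisibility holds in `Λ`: `Char_Λ(𝒳^±_tors) ⊃ Char_Λ(𝒮_±/(κ±_∞))²`.
Moreover, if for some `j > 0` there exists `m ∈ 𝒩_j^def` such that `λ±_j(m)` has non-zero image under
the map `Λ/p^jΛ → Λ/𝔪Λ ≃ 𝔽_p`, then the above divisibility is an equality. Proof. The element `κ±_∞` is
non-torsion by Cornut–Vatsal [CV07] … [BCK21, Lem. 3.6] … The result thus follows from [How06, Thm.
3.2.3] with `k = k(P) = 1` and the ordinary Selmer condition at the primes above `p` replaced by the
`±`-condition, noting that the self-duality of the latter is given by [Kim07, Prop. 4.11], and as shown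
in [CW24, Lem. 6.5] the analogue of the control theorem of [How06, Prop. 3.3.1] follows from [Kim07,
Prop. 4.18]"; [Howard2006, Thm. 3.2.3]: "Assume that the special element (16) is nonzero … (a)
`rank_Λ 𝒮 = rank_Λ X = 1` (b) `ord_𝔭(char(X_{Λ-tors})) ≤ 2 · ord_𝔭(char(𝒮/Λκ^∞))` (c) Equality holds
in (b) if …".  TRANSCRIBED (module docstring (R1)–(R6), READINGS): hypotheses block as in
`thm74_exists_signedBipartiteSystem`; for every topological generator `γ`, every sign `ε`, EVERY system
`B` with `IsSignedBipartiteSystem (W) K p κ γ N ε B` and every `z ∈ 𝒮_ε = AcSigned.selmerLambdaAdic (W⁄K) p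
κ γ (sgn ε)` which is its limit base class (`B.IsLimitBaseClass z.1`) and is NOT `Λ`-torsion
(`AcSigned.IsNonTorsionClass hγ ε z` — (R5): the printed proof's input from [CV07]/[CW24], here a
hypothesis): `𝒮_ε` and `𝒳_ε = AcSigned.X (W⁄K) p κ ∅ (sgn ε)` are finitely generated of `Λ`-rank one
(`selmerLambdaAdic.HasRank … 1`, `X.HasRank … 1`) and `ι(char_Λ(𝒮_ε/Λz))² ⊆ char_Λ(𝒳_{ε,tors})`
(`(signedHeegnerCharIdeal hγ ε z).map ι ^ 2 ≤ X.torsionCharIdeal …`, `ι = IwasawaAlgebra.invol`, the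
orientation of `AcSigned.TransferInputs.mem_XAc_charIdeal_map_of_howard`; (R6), flag `dual-convention`);
and IF `B.HasUnitLambda N` (some `λ_j(m)`, `j > 0`, `m ∈ 𝒩_j^def`, is a unit modulo `𝔪`) THEN also
`char_Λ(𝒳_{ε,tors}) ⊆ ι(char_Λ(𝒮_ε/Λz))²` (equality).  WEAKER than print, never stronger; no `_holds`
expected. [cite: CastellaEtAl2025, Thm. 7.5 and its proof (arXiv:2308.10474v2 p0031 L13–L30)]
[cite: Howard2006, Thm. 3.2.3 and Lem. 3.2.2] [cite: BurungaleCastellaKim2021, arXiv:1908.09512 Prop. 7.4 (journal Lem. 3.6)]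
[cite: CastellaWan2023, Lemma 6.5 and §4.2 (MS pp. 22, 27)] -/
def thm75_howard_rank_one_sq_le_and_le_of_hasUnitLambda : Prop :=
  ∀ (_ : Setting W K p κ 𝔭 𝔭'), (W.conductorNorm ℤ : ℕ) = N → SatisfiesHeegnerHypothesis N K →
    IsCoprime (N : ℤ) (NumberField.discr K) → 5 ≤ p → Rank1Residual.Surj W p →
    ∀ (γ : absoluteGaloisGroup K) (hγ : κ.IsTopGenerator γ) (ε : ℤˣ) (B : SignedBipartiteSystem W K p κ),
      IsSignedBipartiteSystem W K p κ γ N ε B →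
      ∀ z : selmerLambdaAdic (W.baseChange K) p κ γ (fun _ ↦ .sgn ε),
        B.IsLimitBaseClass z.1 → IsNonTorsionClass hγ ε z →
        (selmerLambdaAdic.HasRank (W.baseChange K) p κ γ hγ (fun _ ↦ .sgn ε) 1 ∧
          X.HasRank (W.baseChange K) p κ ∅ (fun _ ↦ .sgn ε) hγ 1 ∧
          (signedHeegnerCharIdeal hγ ε z).map (IwasawaAlgebra.invol p) ^ 2 ≤
            X.torsionCharIdeal (W.baseChange K) p κ ∅ (fun _ ↦ .sgn ε) hγ) ∧
        (B.HasUnitLambda N →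
          X.torsionCharIdeal (W.baseChange K) p κ ∅ (fun _ ↦ .sgn ε) hγ ≤
            (signedHeegnerCharIdeal hγ ε z).map (IwasawaAlgebra.invol p) ^ 2)

variable {N W K p κ 𝔭 𝔭'}

omit [NeZero N] in
/-- **Bookkeeping: Thm. 7.5 with its criterion met gives the `±` Heegner point main conjecture
EQUALITY** `char_Λ(𝒳_{ε,tors}) = ι(char_Λ(𝒮_ε/Λz))²` for the limit base class of a signed bipartite
system with a unit `λ` (the two inequalities of the fact; `le_antisymm`). [cite: CastellaEtAl2025, Thm. 7.5 (arXiv:2308.10474v2 p0031 L13–L20)] -/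
theorem torsionCharIdeal_eq_of_thm75 (h : thm75_howard_rank_one_sq_le_and_le_of_hasUnitLambda N W K p κ 𝔭 𝔭')
    (hS : Setting W K p κ 𝔭 𝔭') (hN : (W.conductorNorm ℤ : ℕ) = N) (hH : SatisfiesHeegnerHypothesis N K)
    (hD : IsCoprime (N : ℤ) (NumberField.discr K)) (hp : 5 ≤ p) (hsurj : Rank1Residual.Surj W p)
    {γ : absoluteGaloisGroup K} (hγ : κ.IsTopGenerator γ) {ε : ℤˣ} {B : SignedBipartiteSystem W K p κ}
    (hB : IsSignedBipartiteSystem W K p κ γ N ε B)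
    (z : selmerLambdaAdic (W.baseChange K) p κ γ (fun _ ↦ .sgn ε)) (hz : B.IsLimitBaseClass z.1)
    (hnt : IsNonTorsionClass hγ ε z) (hNV : B.HasUnitLambda N) :
    X.torsionCharIdeal (W.baseChange K) p κ ∅ (fun _ ↦ .sgn ε) hγ =
      (signedHeegnerCharIdeal hγ ε z).map (IwasawaAlgebra.invol p) ^ 2 := by
  obtain ⟨⟨-, -, hle⟩, hcrit⟩ := h hS hN hH hD hp hsurj γ hγ ε B hB z hz hnt
  exact le_antisymm (hcrit hNV) hle

end Facts

/-! ## Part 7. Bookkeeping for the consumer: Thm. 7.5 for a class admitted by Castella–Wan's transfer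
inputs (PROVED; no new fact) -/

section Consumer

variable {N : ℕ} {W : WeierstrassCurve ℚ} [W.IsGloballyMinimal] {K : Type} [Field K] [NumberField K]
  {p : ℕ} [Fact p.Prime] {κ : ZpExtension K p} {𝔭 𝔭' : HeightOneSpectrum (𝓞 K)}
  {γ : absoluteGaloisGroup K} {hγ : κ.IsTopGenerator γ} {𝔮 : HeightOneSpectrum (𝓞 K)}
  {h𝔮 : IsNonsplitIn κ 𝔮} {γ𝔮 : absoluteGaloisGroup (𝔮.adicCompletion K)}
  {hγ𝔮 : κ (resGalOfEmb (closureEmb (K := K) (𝔮.adicCompletion K)) γ𝔮) = κ γ}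
  {𝔮' : HeightOneSpectrum (𝓞 K)} {h𝔮𝔮' : 𝔮 ≠ 𝔮'} {h𝔮p : ((p : ℕ) : 𝓞 K) ∈ 𝔮.asIdeal} {ε : ℤˣ}
  {z : selmerLambdaAdic (W.baseChange K) p κ γ (fun _ ↦ .sgn ε)} {L : UnrSeries p}

omit [W.IsGloballyMinimal] in
/-- **A class admitted by Castella–Wan's transfer inputs is not `Λ`-torsion** (Cor. 6.4 ⟹ `loc_𝔭(z)`
non-torsion ⟹ `z` non-torsion; the tree theorem `AcSigned.TransferInputs.smul_eq_zero_imp` in the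
currency `AcSigned.IsNonTorsionClass` of `thm75_…`'s hypothesis (R5)). Bookkeeping.
[cite: CastellaWan2023, Cor. 6.4 and proof of Thm. 6.8 (MS pp. 27, 30)] -/
theorem _root_.Literature.NumberTheory.EllipticCurves.AcSigned.TransferInputs.isNonTorsionClass
    (h : TransferInputs (W.baseChange K) p κ γ hγ 𝔮 h𝔮 γ𝔮 hγ𝔮 𝔮' h𝔮𝔮' h𝔮p ε z L) :
    IsNonTorsionClass hγ ε z :=
  fun f hf ↦ h.smul_eq_zero_imp f hf

/-- **Thm. 7.5 for an admissible class of the transfer.**  In the setting of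
`thm75_howard_rank_one_sq_le_and_le_of_hasUnitLambda`, if `z ∈ 𝒮_ε` carries Castella–Wan's transfer
inputs `AcSigned.TransferInputs … ε z L` (the binder of the sibling fact
`castellaWan2024_proofThm68_transferInputs`; it makes `z` non-torsion) and is the limit base class of a
signed bipartite system `B`, then: `𝒮_ε`, `𝒳_ε` have `Λ`-rank one, `ι(char(𝒮_ε/Λz))² ⊆ char(𝒳_{ε,tors})`
(the hypothesis `hHoward` of `AcSigned.TransferInputs.mem_XAc_charIdeal_map_of_howard`), and equality if
`B.HasUnitLambda N`.  The consumer's residual statement for such `z` is thus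
`∃ B, IsSignedBipartiteSystem … B ∧ B.IsLimitBaseClass z.1 ∧ B.HasUnitLambda N`. PROVED composition;
nothing new is asserted. [cite: CastellaEtAl2025, Thm. 7.5 (arXiv:2308.10474v2 p0031 L13–L30)]
[cite: CastellaWan2023, Cor. 6.4 (MS p. 27)] -/
theorem thm75_of_transferInputs
    (h75 : thm75_howard_rank_one_sq_le_and_le_of_hasUnitLambda N W K p κ 𝔭 𝔭')
    (hS : Setting W K p κ 𝔭 𝔭') (hN : (W.conductorNorm ℤ : ℕ) = N) (hH : SatisfiesHeegnerHypothesis N K)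
    (hD : IsCoprime (N : ℤ) (NumberField.discr K)) (hp : 5 ≤ p) (hsurj : Rank1Residual.Surj W p)
    (hz : TransferInputs (W.baseChange K) p κ γ hγ 𝔮 h𝔮 γ𝔮 hγ𝔮 𝔮' h𝔮𝔮' h𝔮p ε z L)
    {B : SignedBipartiteSystem W K p κ} (hB : IsSignedBipartiteSystem W K p κ γ N ε B)
    (hbase : B.IsLimitBaseClass z.1) :
    (selmerLambdaAdic.HasRank (W.baseChange K) p κ γ hγ (fun _ ↦ .sgn ε) 1 ∧
      X.HasRank (W.baseChange K) p κ ∅ (fun _ ↦ .sgn ε) hγ 1 ∧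
      (signedHeegnerCharIdeal hγ ε z).map (IwasawaAlgebra.invol p) ^ 2 ≤
        X.torsionCharIdeal (W.baseChange K) p κ ∅ (fun _ ↦ .sgn ε) hγ) ∧
    (B.HasUnitLambda N →
      X.torsionCharIdeal (W.baseChange K) p κ ∅ (fun _ ↦ .sgn ε) hγ =
        (signedHeegnerCharIdeal hγ ε z).map (IwasawaAlgebra.invol p) ^ 2) := by
  obtain ⟨h1, hcrit⟩ := h75 hS hN hH hD hp hsurj γ hγ ε B hB z hbase hz.isNonTorsionClass
  exact ⟨h1, fun hNV ↦ le_antisymm (hcrit hNV) h1.2.2⟩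

end Consumer

end Literature.NumberTheory.EllipticCurves.CastellaHsuKunduLeeLiu2025

end
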